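import Mathlib.LinearAlgebra.Matrix.ConjTranspose
import Mathlib.Analysis.Matrix.Spectrum
import Literature.Computability.QuantumComplexity.InnerProductEstimation
import HarnessLib

/-!
# Dequantizing the QSVT of a sparse matrix at low degree (Gharibian–Le Gall 2022, §4.1)

Gharibian, Le Gall, *Dequantizing the quantum singular value transformation: hardness and
applications to quantum chemistry and the quantum PCP conjecture*, STOC 2022, 19–32
(= SIAM J. Comput. 52 (2023); arXiv:2111.09079), **§2.1 Definitions 2–3** (query-access to an
`s`-sparse matrix; `ζ`-sampling-access to a vector) and **§4.1 "Main technique"**: the problem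

> `EST(s, ε, ζ)` — Input: query-access to an `s`-sparse matrix `A ∈ ℂ^{M×N}` with `‖A‖ ≤ 1`;
> query-access to a vector `u ∈ ℂᴺ` with `‖u‖ ≤ 1`; `ζ`-sampling-access to a vector `v ∈ ℂᴺ` with
> `‖v‖ ≤ 1`; an even polynomial `P ∈ ℝ[x]` of degree `2d` with `|P(x)| ≤ 1` on `[−1,1]`.
> Output: an estimate `ẑ ∈ ℂ` such that `|ẑ − v† P(√(A†A)) u| ≤ ε`.
>
> **Theorem 3 (formal statement).** For any `s ≥ 2` and any `ε ∈ (0,1]`, the problem `EST(s,ε,ζ)`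
> can be solved classically with probability at least `1 − 1/poly(N)` in `Õ(s^{2d}/ε²)` time, for
> any `ζ ≤ ε/8`.
>
> **Lemma 3.** Let `P ∈ ℝ[x]` be an even polynomial of degree `2d`. There is a `Õ(s^{2d})`-time
> classical procedure that given
> * query-access to an `s`-sparse matrix `A ∈ ℂ^{M×N}`,
> * query-access to a vector `u ∈ ℂᴺ`,
> * an index `i ∈ {1,…,N}`,
>
> outputs the `i`-th entry of `P(√(A†A))u`.

("Theorem 3" is the informal statement of §1.2; its formal version is the displayed theorem of
§4.1.  This is the "Gharibian–Le Gall road" of sparse-access dequantization, complementary to the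
sampling-and-query road of `SampleQueryAccess.lean` / `InnerProductEstimation.lean`: the matrix is
accessed by SPARSE QUERY access, only the measurement vector `v` by sampling access, and the
degree `d` enters the exponent.)

What is formalized — the printed proofs, step by step, the probabilistic part as theorems about
finite weighted sums exactly as in `InnerProductEstimation.lean`:

**Part A (`namespace SparseQuery`, any semiring / commutative star-semiring of entries).**
* §2 "`s`-sparse" (`rowSupport`, `colSupport`, `HasSparseRows`, `HasSparseCols`, `IsSparse`) and
  Def. 2, query-access `𝒬_A^{row}`, `𝒬_A^{col}`: the answer for a row is the LIST of its non-zero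
  entries with positions (`RowOracle`, `RowOracle.Lists` = the `s` answers of Def. 2 collected, `RowOracle.ofMatrix`,
  `colOfMatrix = ofMatrix Aᵀ`; answers of length `≤ s`: `Width`, `ofMatrix_width`); the linear
  consequence actually used by the recursion, `∑_{(k,b) ∈ answer(i)} b f(k) = ∑_k B_{ik} f(k)`
  (`Represents`, `Lists.represents`).
* Lemma 3, the recursive procedure for the `i`-th entry of `B^{[1]}⋯B^{[r]}u` (`recEval`; the
  product itself is `chainMulVec`): correctness (`recEval_eq`) and the cost recursion
  `𝒯(r) ≤ s·𝒯(r−1) + …` as explicit counts on the recursion tree — at most `s^r` queries to `u`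
  (`leafQueries_le`) and `1 + s + ⋯ + s^{r−1}` row queries (`rowQueries_le`).  The printed lemma
  allows rectangular factors of matching shapes; here the factors live on one index set, and the
  rectangular pair `A†, A` of the application is fused into the Gram answer list built from Def. 2's
  two oracles (`RowOracle.gram`: column `i` of `A`, then the rows through it), which represents
  `A†A` (`gram_represents`) with answers of length `≤ s²` (`gram_width`) — the same `s²` per factor
  `A†A` as the paper's `s · s` for the two levels `A†`, `A`.  Hence the `i`-th entry of
  `P(√(A†A))u = ∑_{k≤d} a_{2k}(A†A)^k u` (§2.2; `evenPolyApply`) is computed by `recEvalPoly`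
  (`recEvalPoly_eq`) with `≤ ∑_{k≤d} s^{2k}` queries to `u` (`leafQueriesPoly_le`) — the printed
  `O((s² + s⁴ + ⋯ + s^{2d})·poly log(MN)) = Õ(s^{2d})`.

**Part B (`namespace SampleQuery`, real case, the tree's `normSq` / `lengthSqDist` / `iidWeight` /
`IsMedian` vocabulary).**
* Def. 3, `ζ`-sampling-access (`ZetaSampling ζ v`: a probability vector `p` with
  `(1−ζ)𝒟_v ≤ p ≤ (1+ζ)𝒟_v` and a number `m` with `|m − ‖v‖| ≤ ζ‖v‖`); `ζ = 0` is ordinary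
  sampling access (`ZetaSampling.exact`), and `p` is `(1−ζ)⁻¹`-oversampled in the sense of CGLLTW
  Def. 2.7 (`ZetaSampling.isOversampledDist`, the comparison the paper makes before Def. 3).
* Proof of Theorem 3: the estimator `X = w_j m²/v_j`, `j ∼ p` (`ZetaSampling.est`); the two
  displayed inequalities `m²p(i) ≤ (1+ζ)³|v_i|² ≤ (1+7ζ)|v_i|²`,
  `m²p(i) ≥ (1−ζ)³|v_i|² ≥ (1−4ζ)|v_i|²` (`m_sq_mul_p_le`, `le_m_sq_mul_p`); the bias chain
  `|E[X] − v†w| ≤ 7ζ∑|w_i||v_i| ≤ 7ζ‖w‖‖v‖` (`abs_mean_est_sub_le`); the second-moment chain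
  `E[X²] ≤ (1+7ζ)∑|w_i|²m² ≤ (1+7ζ)(1+ζ)²‖w‖²‖v‖²` (`mean_est_sq_le`); "the variance of the mean of
  `r` independent copies is `Var/r`" + Chebyshev, here about a biased mean
  (`blockMean_far_mass_le_of_bias`, from `ApproxMatrixProduct.sum_iidWeight_mul_sq_avg_sub` and the
  Markov step `mul_sum_filter_le_sum_mul`); "for `ζ ≤ ε/8`, taking `r = Θ(1/ε²)` guarantees …
  probability at least `3/4`" with the explicit admissible constant `r ≥ 1024/ε²`
  (`blockMean_est_far_mass_le_quarter`; the constant is ours, the paper's is `Θ`); and the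
  powering lemma (§2 Lemma 1 = Jerrum–Valiant–Vazirani 1986, Lemma 6.1, in the tree as
  `Complexity.MedianOfMeans.sum_weight_median_far_le_exp`): `q ≥ 8 ln(1/δ)` blocks and ANY median
  give failure weight `≤ δ` (`ZetaSampling.estimation`; the paper takes `δ = 1/poly(N)`).
* Theorem 3 with Lemma 3 plugged in, i.e. the algorithm as printed ("3. Compute the value `w_j`
  using the algorithm of Lemma 3; 4. Output `w_j m²/v_j`"): `sparseQSVT_estimation` — the
  `δ`-guarantee for `vᵀP(√(AᵀA))u` with the estimator computed by `recEvalPoly` on the Gram oracle,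
  together with the per-entry query bound `∑_{k≤d} s^{2k}`.
* The spectral step `‖w‖ ≤ ‖P(√(A†A))‖‖u‖ ≤ 1` (eq. (3): `P(√(A†A)) = ∑_i P(σ_i)v_iv_i†`):
  `normSq_evenPolyApply_le` — for `‖Ax‖ ≤ ‖x‖` (all `x`) and `|P| ≤ 1` on `[−1,1]`,
  `‖P(√(AᵀA))u‖² ≤ ‖u‖²`, through Mathlib's spectral theorem for the real symmetric matrix `AᵀA`
  (`Matrix.IsHermitian.spectral_theorem`; eigenvalues `λ_i = ‖Av_i‖² ∈ [0,1]`); hence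
  `sparseQSVT_estimation_of_norm_le`, Theorem 3 with EXACTLY the printed hypotheses
  `‖A‖ ≤ 1`, `‖u‖ ≤ 1`, `‖v‖ ≤ 1`, `|P(x)| ≤ 1` on `[−1,1]` (section `spectral`).
* **§4.2, Theorem 4 (formal version)** — the problem `SV(s,t₁,t₂,θ₁,θ₂,δ,ζ)` (decide whether `A`
  has a singular value in `[t₁,t₂]` witnessed by `‖Π^{[t₁,t₂]}_A u‖ ≥ δ`, or none in
  `(t₁−θ₁,t₂+θ₂)`), proved along the printed proof MODULO Lemma 4 (the Low–Chuang / GSLW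
  threshold polynomial, an existence statement from approximation theory that is taken here as
  the hypotheses `P ∈ [0,1]` on `[0,1]`, `P ≥ 1−χ` on `[t₁,t₂]`, `P ≤ χ` off `(t₁−θ₁,t₂+θ₂)`,
  `χ = δ²/3`): the squared singular values `σ_i²` = eigenvalues of `AᵀA` (`singularValueSq`, with
  `σ_i² = ‖Av_i‖² ∈ [0,1]`), the coefficients `α_i = ⟨v_i,u⟩` (`singularCoeff`, `∑α_i² = ‖u‖²`),
  `u†P(√(A†A))u = ∑_i P(σ_i)|α_i|²` (`inner_evenPolyApply`), the two displayed chains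
  `≥ (1−χ)δ² ≥ 2δ²/3` / `≤ χ ≤ δ²/3` (`inner_evenPolyApply_ge` / `_le`), and the decision by
  `EST(s, ε = δ²/7, ζ ≤ δ²/56)` with threshold `δ²/2`: wrong answers have weight `≤ η` in either
  case (`singularValue_decision`, section `svt`).
* **§4.3, proof of Theorem 1 from Proposition 1** — the interval scan: `2r` gapped threshold
  decisions on `[a_i,b_i] = [(i−r−1)/r,(i−r)/r]` that never err yield `|λ − (i₀−r)/r| ≤ 1/r` for
  `i₀ = #{answers "≥"}` (the paper's cases (a)/(b)/(c) in one statement), hence an `ε`-additive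
  approximation for `r ≥ 1/ε` (`thresholdScan_estimate`, section `intervalScan` at the end).

Conventions and scope.  Part B is the REAL case (`v, u, A` real, one median), as the rest of the
tree's sampling-access vocabulary; the paper is over `ℂ` and takes medians of real and imaginary
parts separately at level `ε/√2` with a union bound (`-- TODO(general form): complex entries`).
The hypothesis `‖w‖ ≤ 1` for `w = P(√(A†A))u` is carried explicitly by `sparseQSVT_estimation`
and DISCHARGED from `‖A‖ ≤ 1`, `‖u‖ ≤ 1`, `|P| ≤ 1` on `[−1,1]` — as the paper does through the
singular value decomposition (eq. (3)) — by `normSq_evenPolyApply_le` /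
`sparseQSVT_estimation_of_norm_le`; the operator-norm hypothesis `‖A‖ ≤ 1` is stated in the
elementary form `∀ x, ‖Ax‖² ≤ ‖x‖²`.
Running times are represented by the two query counts of the recursion; the `poly log(MN)` cost
of one oracle call and unit-cost arithmetic (§2, first paragraph) are bookkeeping and not
modelled.  Division junk values: `X = w_j m²/v_j` is `0` at `v_j = 0`, an index of `p`-weight `0`
(`ZetaSampling.p_eq_zero`), so all identities hold as printed.  No named facts are introduced;
everything stated is proved.

## References
* [GharibianLegall2022] S. Gharibian, F. Le Gall, STOC 2022, 19–32, doi:10.1145/3519935.3519991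
  (= SIAM J. Comput. 52(4), 2023; arXiv:2111.09079; numbering of the arXiv/STOC text held as
  `paper:arxiv-2111.09079`) — §2 (unit-cost arithmetic, "`s`-sparse", Lemma 1 = powering lemma),
  §2.1 Definitions 1–3, §2.2 (definition of `P(√(A†A))`, the display preceding eq. (3)), §4.1
  problem `EST(s,ε,ζ)`, Theorem 3 (formal statement),
  Lemma 3 and both proofs; §4.2 problem `SV(s,t₁,t₂,θ₁,θ₂,δ,ζ)`, Theorem 4 (formal version) and
  its proof, Lemma 4 (statement only, as hypotheses); §4.3 proof of Theorem 1 from Proposition 1 (the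
  interval scan).
* [JerrumValiantVazirani1986] M. R. Jerrum, L. G. Valiant, V. V. Vazirani, Theoret. Comput. Sci. 43
  (1986) 169–188, Lemma 6.1 (powering lemma) — via `Literature/Computability/Complexity/MedianOfMeans`.
* [ChiaEtAl2022] N.-H. Chia, A. Gilyén, T. Li, H.-H. Lin, E. Tang, C. Wang, J. ACM 69(5):33, 2022,
  Def. 2.7 (`φ`-oversampling) — for the bridge lemma `ZetaSampling.isOversampledDist`.
* [TangEwin2019] E. Tang, STOC 2019, Prop. 4.2 — the `ζ = 0` estimator ("similar to Proposition 4.2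
  in [Tang STOC19]", §4.1).
-/

noncomputable section

namespace Literature.Computability.QuantumComplexity

namespace SparseQuery

open Finset Matrix

section support

variable {ι κ : Type*} {R : Type*} [Semiring R]

open Classical in
/-- The set of positions of the non-zero entries of row `i`. [cite: GharibianLegall2022, §2
("at most `s` non-zero entries per row and column") and §2.1 Definition 2] -/
def rowSupport [Fintype κ] (B : Matrix ι κ R) (i : ι) : Finset κ := univ.filter fun k => B i k ≠ 0

open Classical in
/-- The set of positions of the non-zero entries of column `k`. [cite: GharibianLegall2022, §2 and
§2.1 Definition 2] -/
def colSupport [Fintype ι] (B : Matrix ι κ R) (k : κ) : Finset ι := univ.filter fun i => B i k ≠ 0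

/-- Every row has at most `s` non-zero entries. [cite: GharibianLegall2022, §2 ("`s`-sparse")] -/
def HasSparseRows [Fintype κ] (s : ℕ) (B : Matrix ι κ R) : Prop := ∀ i, (rowSupport B i).card ≤ s

/-- Every column has at most `s` non-zero entries. [cite: GharibianLegall2022, §2 ("`s`-sparse")] -/
def HasSparseCols [Fintype ι] (s : ℕ) (B : Matrix ι κ R) : Prop := ∀ k, (colSupport B k).card ≤ s

/-- GL22's sparsity notion: "for any integer `s ≥ 1`, we say that a matrix is `s`-sparse if each row
and column has at most `s` non-zero entries". [cite: GharibianLegall2022, §2 Preliminaries] -/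
def IsSparse [Fintype ι] [Fintype κ] (s : ℕ) (B : Matrix ι κ R) : Prop := HasSparseRows s B ∧ HasSparseCols s B

/-- Membership in the row support. [cite: GharibianLegall2022, §2 ("non-zero entries per row")] -/
theorem mem_rowSupport [Fintype κ] {B : Matrix ι κ R} {i : ι} {k : κ} : k ∈ rowSupport B i ↔ B i k ≠ 0 := by
  classical
  simp [rowSupport]

/-- Membership in the column support. [cite: GharibianLegall2022, §2 ("… and column")] -/
theorem mem_colSupport [Fintype ι] {B : Matrix ι κ R} {i : ι} {k : κ} : i ∈ colSupport B k ↔ B i k ≠ 0 := by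
  classical
  simp [colSupport]

/-- The column support of `B` is the row support of `Bᵀ`. [cite: GharibianLegall2022, §2.1
Definition 2] -/
theorem rowSupport_transpose [Fintype ι] (B : Matrix ι κ R) (k : κ) :
    rowSupport Bᵀ k = colSupport B k := by
  classical
  ext i
  simp [rowSupport, colSupport]

/-- `s`-sparse columns of `B` = `s`-sparse rows of `Bᵀ`. [cite: GharibianLegall2022, §2] -/
theorem hasSparseRows_transpose [Fintype ι] {s : ℕ} {B : Matrix ι κ R} (h : HasSparseCols s B) :
    HasSparseRows s Bᵀ := fun k => by rw [rowSupport_transpose]; exact h k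

/-- A row functional only sees the row support: `∑_k B(i,k) f(k) = ∑_{k ∈ supp} B(i,k) f(k)`.
[cite: GharibianLegall2022, §4.1, proof of Lemma 3 ("queries all the entries of the `i`-th row of
`B^{[1]}`, and gets at most `s` non-zero entries and their positions")] -/
theorem sum_row_mul_eq_sum_rowSupport [Fintype κ] (B : Matrix ι κ R) (i : ι) (f : κ → R) :
    ∑ k, B i k * f k = ∑ k ∈ rowSupport B i, B i k * f k := by
  classical
  refine (sum_subset (subset_univ _) fun k _ hk => ?_).symm
  have : B i k = 0 := by simpa [mem_rowSupport] using hk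
  simp [this]

/-- `(B x)(i) = ∑_{k ∈ supp(i)} B(i,k) x(k)`. [cite: GharibianLegall2022, §4.1, proof of Lemma 3] -/
theorem mulVec_eq_sum_rowSupport [Fintype κ] (B : Matrix ι κ R) (x : κ → R) (i : ι) :
    (B *ᵥ x) i = ∑ k ∈ rowSupport B i, B i k * x k := by
  rw [← sum_row_mul_eq_sum_rowSupport]
  rfl

end support

/-! ### Query-access to a sparse matrix (Def. 2) -/

/-- **Query-access to the rows of a sparse matrix** [GL22 Def. 2, `𝒬_A^{row}`: "on input `(i, ℓ)`
outputs the `ℓ`-th non-zero entry of the `i`-th row of `A` if this row has at least `ℓ` non-zero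
entries, and outputs an error message otherwise"].  We record the whole answer for row `i` as the LIST of
(position, value) pairs; `entries i`, of length `≤ s`, is exactly the information returned by the
`s` calls `𝒬^{row}(i,1), …, 𝒬^{row}(i,s)`.  The same structure on the transpose models
`𝒬_A^{col}` (`colOfMatrix`). [cite: GharibianLegall2022, §2.1 Definition 2] -/
structure RowOracle (ι κ : Type*) (R : Type*) where
  /-- row index `↦` the listed (column position, value) pairs -/
  entries : ι → List (κ × R)

namespace RowOracle

variable {ι κ : Type*} {R : Type*} [Semiring R]

/-- **Def. 2, the `s` answers collected**: the answer for row `i` lists pairs `(k, B(i,k))` with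
pairwise distinct positions, among them every non-zero entry of the row.
[cite: GharibianLegall2022, §2.1 Definition 2] -/
structure Lists (O : RowOracle ι κ R) (B : Matrix ι κ R) : Prop where
  /-- listed values are entries of the row -/
  value : ∀ i, ∀ e ∈ O.entries i, e.2 = B i e.1
  /-- listed positions are pairwise distinct -/
  nodup : ∀ i, ((O.entries i).map Prod.fst).Nodup
  /-- every non-zero entry is listed -/
  cover : ∀ i k, B i k ≠ 0 → k ∈ (O.entries i).map Prod.fst

/-- The weaker, linear form used by the recursion: for every row `i` and every test vector `f`,
`∑_{(k,b) ∈ entries i} b·f(k) = ∑_k B(i,k) f(k)` ("the procedure finally outputs the value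
`B_{i,j_1} y_1 + ⋯ + B_{i,j_ℓ} y_ℓ`, which is equal to the `i`-th entry").  Implied by `Lists`;
also satisfied by answer lists with repeated positions whose values add up (`gram`).
[cite: GharibianLegall2022, §4.1, proof of Lemma 3] -/
def Represents [Fintype κ] (O : RowOracle ι κ R) (B : Matrix ι κ R) : Prop :=
  ∀ i (f : κ → R), ((O.entries i).map fun e => e.2 * f e.1).sum = ∑ k, B i k * f k

/-- Every answer has at most `s` entries.
[cite: GharibianLegall2022, §2.1 Definition 2 ("`(i,ℓ) ∈ {1,…,M} × {1,…,s}`")] -/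
def Width (O : RowOracle ι κ R) (s : ℕ) : Prop := ∀ i, (O.entries i).length ≤ s

/-- The canonical row oracle of Def. 2: row `i ↦` the list of its non-zero entries with their
positions (in a fixed enumeration order). [cite: GharibianLegall2022, §2.1 Definition 2] -/
def ofMatrix [Fintype κ] (B : Matrix ι κ R) : RowOracle ι κ R :=
  ⟨fun i => (rowSupport B i).toList.map fun k => (k, B i k)⟩

/-- The canonical column oracle `𝒬_A^{col}` of Def. 2 = the row oracle of `Aᵀ`: column `k ↦` the
list of its non-zero entries `(j, A(j,k))`. [cite: GharibianLegall2022, §2.1 Definition 2] -/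
def colOfMatrix [Fintype ι] (B : Matrix ι κ R) : RowOracle κ ι R := ofMatrix Bᵀ

/-- Summing any entry-wise expression that vanishes on zero entries over a Def.-2 answer list gives
the sum over the whole row. [cite: GharibianLegall2022, §2.1 Definition 2; §4.1 proof of Lemma 3] -/
theorem Lists.sum_map_eq [Fintype κ] {O : RowOracle ι κ R} {B : Matrix ι κ R} (h : O.Lists B) (i : ι)
    {M : Type*} [AddCommMonoid M] (g : κ → R → M) (hg : ∀ k, g k 0 = 0) :
    ((O.entries i).map fun e => g e.1 e.2).sum = ∑ k, g k (B i k) := by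
  classical
  have hmap : ((O.entries i).map fun e => g e.1 e.2)
      = (((O.entries i).map Prod.fst).map fun k => g k (B i k)) := by
    rw [List.map_map]
    refine List.map_congr_left fun e he => ?_
    simp [h.value i e he]
  rw [hmap, ← List.sum_toFinset _ (h.nodup i)]
  refine sum_subset (subset_univ _) fun k _ hk => ?_
  have hBk : B i k = 0 := by
    by_contra hne
    exact hk (List.mem_toFinset.2 (h.cover i k hne))
  rw [hBk, hg]

/-- A Def.-2 oracle represents the row functionals. [cite: GharibianLegall2022, §2.1 Definition 2] -/
theorem Lists.represents [Fintype κ] {O : RowOracle ι κ R} {B : Matrix ι κ R} (h : O.Lists B) :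
    O.Represents B :=
  fun i f => h.sum_map_eq i (fun k b => b * f k) (fun k => by simp)

/-- The canonical oracle lists the rows. [cite: GharibianLegall2022, §2.1 Definition 2] -/
theorem ofMatrix_lists [Fintype κ] (B : Matrix ι κ R) : (ofMatrix B).Lists B where
  value i e he := by
    simp only [ofMatrix, List.mem_map] at he
    obtain ⟨k, -, rfl⟩ := he
    rfl
  nodup i := by
    simp only [ofMatrix, List.map_map, Function.comp_def, List.map_id']
    exact Finset.nodup_toList _
  cover i k hk := by
    simp only [ofMatrix, List.map_map, Function.comp_def, List.map_id', Finset.mem_toList]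
    exact mem_rowSupport.2 hk

/-- The canonical oracle represents the rows. [cite: GharibianLegall2022, §2.1 Definition 2] -/
theorem ofMatrix_represents [Fintype κ] (B : Matrix ι κ R) : (ofMatrix B).Represents B :=
  (ofMatrix_lists B).represents

/-- The canonical column oracle lists the columns (= the rows of `Aᵀ`).
[cite: GharibianLegall2022, §2.1 Definition 2 (`𝒬_A^{col}`)] -/
theorem colOfMatrix_lists [Fintype ι] (B : Matrix ι κ R) : (colOfMatrix B).Lists Bᵀ := ofMatrix_lists Bᵀ

/-- For a matrix with `s`-sparse rows the canonical answers have length `≤ s`.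
[cite: GharibianLegall2022, §2.1 Definition 2] -/
theorem ofMatrix_width [Fintype κ] {s : ℕ} {B : Matrix ι κ R} (h : HasSparseRows s B) :
    (ofMatrix B).Width s := by
  intro i
  simpa [ofMatrix, Finset.length_toList] using h i

/-- For a matrix with `s`-sparse columns the canonical column answers have length `≤ s`.
[cite: GharibianLegall2022, §2.1 Definition 2] -/
theorem colOfMatrix_width [Fintype ι] {s : ℕ} {B : Matrix ι κ R} (h : HasSparseCols s B) :
    (colOfMatrix B).Width s :=
  ofMatrix_width (hasSparseRows_transpose h)

end RowOracle

/-! ### Lemma 3: recursive evaluation of one entry of `B^{[1]} ⋯ B^{[r]} u` -/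

section chain

variable {ι : Type*} {R : Type*}

/-- `B^{[1]} B^{[2]} ⋯ B^{[r]} u` for a list of matrices on a common index set.
[cite: GharibianLegall2022, §4.1, proof of Lemma 3 ("the `i`-th entry of the vector
`B^{[1]}⋯B^{[r]}u`")] -/
def chainMulVec [Fintype ι] [Semiring R] : List (Matrix ι ι R) → (ι → R) → ι → R
  | [], u => u
  | B :: Bs, u => B *ᵥ chainMulVec Bs u

/-- **The recursive procedure of Lemma 3.** On input the oracles of `B^{[1]},…,B^{[r]}`, query
access to `u` and an index `i`: query row `i` of `B^{[1]}` (positions `j_1,…,j_ℓ`, `ℓ ≤ s`),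
recursively compute the `j_q`-th entries `y_q` of `B^{[2]}⋯B^{[r]}u`, and output
`B^{[1]}_{i,j_1} y_1 + ⋯ + B^{[1]}_{i,j_ℓ} y_ℓ`; with no matrix left, output `u_i` (one query to `u`).
[cite: GharibianLegall2022, §4.1, proof of Lemma 3] -/
def recEval [Semiring R] : List (RowOracle ι ι R) → (ι → R) → ι → R
  | [], u, i => u i
  | O :: Os, u, i => ((O.entries i).map fun e => e.2 * recEval Os u e.1).sum

/-- Number of queries to `u` (leaves of the recursion tree) made by `recEval` on index `i`.
[cite: GharibianLegall2022, §4.1, proof of Lemma 3 (`𝒯(r) ≤ s·O(poly log(MN)) + s𝒯(r−1) + s`)] -/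
def leafQueries : List (RowOracle ι ι R) → ι → ℕ
  | [], _ => 1
  | O :: Os, i => ((O.entries i).map fun e => leafQueries Os e.1).sum

/-- Number of row queries (internal nodes of the recursion tree) made by `recEval` on index `i`.
[cite: GharibianLegall2022, §4.1, proof of Lemma 3 (`𝒯(r) ≤ s·O(poly log(MN)) + s𝒯(r−1) + s`)] -/
def rowQueries : List (RowOracle ι ι R) → ι → ℕ
  | [], _ => 0
  | O :: Os, i => 1 + ((O.entries i).map fun e => rowQueries Os e.1).sum

/-- Empty product: `u` itself. [cite: GharibianLegall2022, §4.1, proof of Lemma 3] -/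
@[simp] theorem chainMulVec_nil [Fintype ι] [Semiring R] (u : ι → R) :
    chainMulVec ([] : List (Matrix ι ι R)) u = u := by
  simp [chainMulVec]

/-- `B^{[1]}(B^{[2]}⋯B^{[r]}u)`. [cite: GharibianLegall2022, §4.1, proof of Lemma 3] -/
@[simp] theorem chainMulVec_cons [Fintype ι] [Semiring R] (B : Matrix ι ι R) (Bs : List (Matrix ι ι R))
    (u : ι → R) : chainMulVec (B :: Bs) u = B *ᵥ chainMulVec Bs u := by
  simp [chainMulVec]

/-- Base of the recursion: one query to `u`. [cite: GharibianLegall2022, §4.1, proof of Lemma 3] -/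
@[simp] theorem recEval_nil [Semiring R] (u : ι → R) (i : ι) :
    recEval ([] : List (RowOracle ι ι R)) u i = u i := rfl

/-- Step of the recursion: `B^{[1]}_{i,j_1} y_1 + ⋯ + B^{[1]}_{i,j_ℓ} y_ℓ`.
[cite: GharibianLegall2022, §4.1, proof of Lemma 3] -/
theorem recEval_cons [Semiring R] (O : RowOracle ι ι R) (Os : List (RowOracle ι ι R)) (u : ι → R) (i : ι) :
    recEval (O :: Os) u i = ((O.entries i).map fun e => e.2 * recEval Os u e.1).sum := rfl

/-- Base: one query to `u`. [cite: GharibianLegall2022, §4.1, proof of Lemma 3] -/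
@[simp] theorem leafQueries_nil (i : ι) : leafQueries ([] : List (RowOracle ι ι R)) i = 1 := rfl

/-- Step: the queries of the `ℓ ≤ s` sub-calls. [cite: GharibianLegall2022, §4.1, proof of Lemma 3
(`𝒯(r) ≤ … + s𝒯(r−1) + …`)] -/
theorem leafQueries_cons (O : RowOracle ι ι R) (Os : List (RowOracle ι ι R)) (i : ι) :
    leafQueries (O :: Os) i = ((O.entries i).map fun e => leafQueries Os e.1).sum := rfl

/-- Base: no row query. [cite: GharibianLegall2022, §4.1, proof of Lemma 3] -/
@[simp] theorem rowQueries_nil (i : ι) : rowQueries ([] : List (RowOracle ι ι R)) i = 0 := rfl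

/-- Step: one row query plus those of the `ℓ ≤ s` sub-calls. [cite: GharibianLegall2022, §4.1,
proof of Lemma 3 (`𝒯(r) ≤ s·O(poly log(MN)) + s𝒯(r−1) + s`)] -/
theorem rowQueries_cons (O : RowOracle ι ι R) (Os : List (RowOracle ι ι R)) (i : ι) :
    rowQueries (O :: Os) i = 1 + ((O.entries i).map fun e => rowQueries Os e.1).sum := rfl

/-- **Lemma 3 (correctness of the recursion).** If the oracles represent the rows of
`B^{[1]},…,B^{[r]}`, the recursive procedure outputs the `i`-th entry of `B^{[1]}⋯B^{[r]}u`
("which is equal to the `i`-th entry of the vector `B^{[1]}⋯B^{[r]}u`").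
[cite: GharibianLegall2022, §4.1 Lemma 3, proof] -/
theorem recEval_eq [Fintype ι] [Semiring R] {Os : List (RowOracle ι ι R)} {Bs : List (Matrix ι ι R)}
    (h : List.Forall₂ (fun O B => O.Represents B) Os Bs) (u : ι → R) (i : ι) :
    recEval Os u i = chainMulVec Bs u i := by
  induction h generalizing i with
  | nil => simp
  | @cons O B Os Bs hOB _ ih =>
      rw [recEval_cons, chainMulVec_cons]
      have hmap : ((O.entries i).map fun e => e.2 * recEval Os u e.1)
          = ((O.entries i).map fun e => e.2 * chainMulVec Bs u e.1) := by
        refine List.map_congr_left fun e _ => ?_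
        rw [ih]
      rw [hmap, hOB i (chainMulVec Bs u)]
      simp [Matrix.mulVec, dotProduct]

/-- **Lemma 3 (cost of the recursion), queries to `u`.** With answers of length `≤ s`, the recursion
on `r` matrices queries `u` at most `s^r` times (`𝒯(r) ≤ s𝒯(r−1) + …`, so `𝒯(r) = O(s^r …)`).
[cite: GharibianLegall2022, §4.1 Lemma 3, proof ("and thus `𝒯(r) = O(s^r · poly(log(MN)))`")] -/
theorem leafQueries_le {s : ℕ} {Os : List (RowOracle ι ι R)} (hw : ∀ O ∈ Os, O.Width s) (i : ι) :
    leafQueries Os i ≤ s ^ Os.length := by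
  induction Os generalizing i with
  | nil => simp
  | cons O Os ih =>
      rw [leafQueries_cons, List.length_cons, pow_succ]
      have hO : (O.entries i).length ≤ s := hw O (by simp) i
      have hOs : ∀ O' ∈ Os, O'.Width s := fun O' hO' => hw O' (by simp [hO'])
      calc ((O.entries i).map fun e => leafQueries Os e.1).sum
          ≤ ((O.entries i).map fun _ => s ^ Os.length).sum :=
            List.sum_le_sum fun e _ => ih hOs e.1
        _ = (O.entries i).length * s ^ Os.length := by
            simp [List.map_const', List.sum_replicate, smul_eq_mul]
        _ ≤ s * s ^ Os.length := Nat.mul_le_mul_right _ hO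
        _ = s ^ Os.length * s := mul_comm _ _

/-- **Lemma 3 (cost of the recursion), row queries.** With answers of length `≤ s`, the recursion on
`r` matrices makes at most `1 + s + ⋯ + s^{r−1}` row queries (internal nodes of the recursion tree).
[cite: GharibianLegall2022, §4.1 Lemma 3, proof (`𝒯(r) ≤ s·O(poly(log(MN))) + s𝒯(r−1) + s`)] -/
theorem rowQueries_le {s : ℕ} {Os : List (RowOracle ι ι R)} (hw : ∀ O ∈ Os, O.Width s) (i : ι) :
    rowQueries Os i ≤ ∑ t ∈ range Os.length, s ^ t := by
  induction Os generalizing i with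
  | nil => simp
  | cons O Os ih =>
      rw [rowQueries_cons, List.length_cons]
      have hO : (O.entries i).length ≤ s := hw O (by simp) i
      have hOs : ∀ O' ∈ Os, O'.Width s := fun O' hO' => hw O' (by simp [hO'])
      have hsum : ((O.entries i).map fun e => rowQueries Os e.1).sum
          ≤ s * ∑ t ∈ range Os.length, s ^ t :=
        calc ((O.entries i).map fun e => rowQueries Os e.1).sum
            ≤ ((O.entries i).map fun _ => ∑ t ∈ range Os.length, s ^ t).sum :=
              List.sum_le_sum fun e _ => ih hOs e.1
          _ = (O.entries i).length * ∑ t ∈ range Os.length, s ^ t := by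
              simp [List.map_const', List.sum_replicate, smul_eq_mul]
          _ ≤ s * ∑ t ∈ range Os.length, s ^ t := Nat.mul_le_mul_right _ hO
      rw [Finset.sum_range_succ', pow_zero, add_comm (∑ t ∈ range Os.length, s ^ (t + 1)) 1]
      refine Nat.add_le_add le_rfl (hsum.trans_eq ?_)
      rw [Finset.mul_sum]
      exact Finset.sum_congr rfl fun t _ => by rw [pow_succ, mul_comm]

/-- `r` copies of the same factor: `chainMulVec [G,…,G] u = G^r u`.
[cite: GharibianLegall2022, §4.1, proof of Lemma 3 ("each term `(A†A)^r u`, for `r ∈ {1,…,d}`")] -/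
theorem chainMulVec_replicate [Fintype ι] [DecidableEq ι] [Semiring R] (G : Matrix ι ι R) (u : ι → R) (r : ℕ) :
    chainMulVec (List.replicate r G) u = (G ^ r) *ᵥ u := by
  induction r with
  | zero => simp
  | succ r ih =>
      rw [List.replicate_succ, chainMulVec_cons, ih, Matrix.mulVec_mulVec, pow_succ']

/-- Replicated oracles represent replicated factors. [cite: GharibianLegall2022, §4.1, proof of
Lemma 3] -/
theorem forall₂_replicate [Fintype ι] [Semiring R] {O : RowOracle ι ι R} {G : Matrix ι ι R}
    (h : O.Represents G) (r : ℕ) :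
    List.Forall₂ (fun O B => RowOracle.Represents O B) (List.replicate r O) (List.replicate r G) := by
  induction r with
  | zero => exact List.Forall₂.nil
  | succ r ih => exact List.Forall₂.cons h ih

end chain

/-! ### The Gram factor `A†A` from the two oracles of Def. 2, and `P(√(A†A))u` -/

section gram

variable {ι κ : Type*} {R : Type*} [CommSemiring R] [StarRing R]

/-- Row `i` of `A†A` assembled from Def. 2's two oracles: query COLUMN `i` of `A` (entries
`(j, A_{j i})`), and for each such `j` query ROW `j` of `A` (entries `(k, A_{j k})`), listing
`(k, conj(A_{j i}) A_{j k})` — the two consecutive levels `B^{[2t−1]} = A†`, `B^{[2t]} = A` of the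
recursion of Lemma 3 applied to the factors of `(A†A)^r`.
[cite: GharibianLegall2022, §4.1, proof of Lemma 3 (the terms `(A†A)^r u`); §2.1 Definition 2] -/
def RowOracle.gram (rowO : RowOracle ι κ R) (colO : RowOracle κ ι R) : RowOracle κ κ R :=
  ⟨fun i => (colO.entries i).flatMap fun e =>
    (rowO.entries e.1).map fun e' => (e'.1, star e.2 * e'.2)⟩

omit [StarRing R] in
/-- Summing over a concatenation of lists = summing the partial sums. [folklore] -/
private theorem sum_map_flatMap {α β : Type*} (l : List α) (g : α → List β) (F : β → R) :
    ((l.flatMap g).map F).sum = (l.map fun a => ((g a).map F).sum).sum := by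
  induction l with
  | nil => simp
  | cons a l ih => simp [List.flatMap_cons, List.map_append, List.sum_append, ih]

/-- The assembled answers represent the rows of `A†A`:
`∑_j conj(A_{ji}) (∑_k A_{jk} f(k)) = ∑_k (A†A)_{ik} f(k)`.
[cite: GharibianLegall2022, §4.1, proof of Lemma 3; §2.2 (`P(√(A†A)) = a_0 I + a_2 A†A + ⋯`)] -/
theorem RowOracle.gram_represents [Fintype ι] [Fintype κ] {rowO : RowOracle ι κ R} {colO : RowOracle κ ι R}
    {A : Matrix ι κ R} (hr : rowO.Represents A) (hc : colO.Lists Aᵀ) :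
    (rowO.gram colO).Represents (Aᴴ * A) := by
  intro i f
  simp only [RowOracle.gram]
  rw [sum_map_flatMap]
  simp only [List.map_map, Function.comp_def]
  have hinner : ∀ e : ι × R, ((rowO.entries e.1).map fun e' => star e.2 * e'.2 * f e'.1).sum
      = star e.2 * ∑ k, A e.1 k * f k := by
    intro e
    rw [← hr e.1 f, ← List.sum_map_mul_left]
    simp only [mul_assoc]
  simp only [hinner]
  rw [hc.sum_map_eq i (fun j a => star a * ∑ k, A j k * f k) (fun j => by simp)]
  simp only [Matrix.transpose_apply, Matrix.mul_apply, Matrix.conjTranspose_apply, Finset.mul_sum,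
    Finset.sum_mul]
  rw [Finset.sum_comm]
  exact Finset.sum_congr rfl fun j _ => Finset.sum_congr rfl fun k _ => by ring

/-- A list of naturals each `≤ s` sums to `≤ length · s`. [folklore] -/
private theorem sum_map_le_length_mul {α : Type*} (l : List α) (g : α → ℕ) {s : ℕ}
    (h : ∀ a ∈ l, g a ≤ s) : (l.map g).sum ≤ l.length * s := by
  calc (l.map g).sum ≤ (l.map fun _ => s).sum := List.sum_le_sum h
    _ = l.length * s := by simp [List.map_const', List.sum_replicate, smul_eq_mul]

/-- The assembled answers have length `≤ s·s` (an `s`-sparse column times `s`-sparse rows).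
[cite: GharibianLegall2022, §4.1, proof of Lemma 3 ("`O((s² + ⋯ + s^{2d}) · poly(log(MN)))`")] -/
theorem RowOracle.gram_width {rowO : RowOracle ι κ R} {colO : RowOracle κ ι R} {s : ℕ}
    (hr : rowO.Width s) (hc : colO.Width s) : (rowO.gram colO).Width (s * s) := by
  intro i
  simp only [RowOracle.gram, List.length_flatMap, List.length_map]
  calc ((colO.entries i).map fun e => (rowO.entries e.1).length).sum
      ≤ (colO.entries i).length * s := sum_map_le_length_mul _ _ fun e _ => hr e.1
    _ ≤ s * s := Nat.mul_le_mul_right _ (hc i)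

end gram

section poly

variable {ι κ : Type*} {R : Type*} {d : ℕ}

/-- `P(√(A†A)) u = ∑_{k=0}^{d} a_{2k} (A†A)^k u` for the even polynomial
`P(x) = a_0 + a_2 x² + ⋯ + a_{2d} x^{2d}` (coefficient of `x^{2k}` stored at `k : Fin (d+1)`).
[cite: GharibianLegall2022, §2.2 (the display preceding eq. (3)) and §4.1, proof of Lemma 3
("`P(√(A†A))u = a_0 u + a_2 A†Au + ⋯ + a_{2d}(A†A)^d u`")] -/
def evenPolyApply [Fintype ι] [Fintype κ] [DecidableEq κ] [CommSemiring R] [StarRing R] (a : Fin (d + 1) → R) (A : Matrix ι κ R) (u : κ → R) : κ → R :=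
  fun i => ∑ k : Fin (d + 1), a k * (((Aᴴ * A) ^ (k : ℕ)) *ᵥ u) i

/-- Lemma 3's procedure for `P`: the `i`-th entry of each term `(A†A)^k u` by the recursion on `k`
Gram factors, combined with the coefficients. [cite: GharibianLegall2022, §4.1, proof of Lemma 3] -/
def recEvalPoly [Fintype κ] [Semiring R] (a : Fin (d + 1) → R) (G : RowOracle κ κ R) (u : κ → R) (i : κ) : R :=
  ∑ k : Fin (d + 1), a k * recEval (List.replicate k G) u i

/-- Queries to `u` made by `recEvalPoly` on index `i`. [cite: GharibianLegall2022, §4.1, proof of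
Lemma 3] -/
def leafQueriesPoly (d : ℕ) (G : RowOracle κ κ R) (i : κ) : ℕ :=
  ∑ k : Fin (d + 1), leafQueries (List.replicate k G) i

/-- **Lemma 3, as used**: the procedure outputs the `i`-th entry of `P(√(A†A))u`.
[cite: GharibianLegall2022, §4.1 Lemma 3 ("outputs the `i`-th entry of `P(√(A†A))u`")] -/
theorem recEvalPoly_eq [Fintype ι] [Fintype κ] [DecidableEq κ] [CommSemiring R] [StarRing R]
    {a : Fin (d + 1) → R} {G : RowOracle κ κ R} {A : Matrix ι κ R} (hG : G.Represents (Aᴴ * A)) (u : κ → R) (i : κ) :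
    recEvalPoly a G u i = evenPolyApply a A u i := by
  unfold recEvalPoly evenPolyApply
  refine Finset.sum_congr rfl fun k _ => ?_
  rw [recEval_eq (forall₂_replicate hG k), chainMulVec_replicate]

/-- **Lemma 3, cost**: with Gram answers of length `≤ s²` (`gram_width`), one entry of `P(√(A†A))u`
costs at most `∑_{k ≤ d} s^{2k}` queries to `u` — the printed `O((s² + ⋯ + s^{2d})·poly log) =
Õ(s^{2d})`. [cite: GharibianLegall2022, §4.1 Lemma 3 ("There is a `Õ(s^{2d})`-time classical
procedure …")] -/
theorem leafQueriesPoly_le {s : ℕ} {G : RowOracle κ κ R} (hG : G.Width (s * s)) (i : κ) :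
    leafQueriesPoly d G i ≤ ∑ k : Fin (d + 1), s ^ (2 * (k : ℕ)) := by
  unfold leafQueriesPoly
  refine Finset.sum_le_sum fun k _ => ?_
  have h := leafQueries_le (Os := List.replicate k G) (fun O hO => by
    rw [List.eq_of_mem_replicate hO]; exact hG) i
  rw [List.length_replicate] at h
  refine h.trans_eq ?_
  rw [pow_mul, sq]

end poly

end SparseQuery

/-! ## Part B. `ζ`-sampling-access (Def. 3) and the estimator of Theorem 3 (§4.1), real case -/

namespace SampleQuery

open Finset Matrix Literature.Computability.Complexity

variable {n : ℕ}

/-- **`ζ`-sampling-access to a vector** [GL22 Def. 3], real case.  Condition (i) (query-access) is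
the function `v` itself; (ii) a probability distribution `p` on `[N]` with
`p(j) ∈ [(1−ζ)|v_j|²/‖v‖², (1+ζ)|v_j|²/‖v‖²]`; (iii) a real number `m` with `|m − ‖v‖| ≤ ζ‖v‖`.
"We simply say that we have sampling-access to `u` … if we have `0`-sampling-access."
[cite: GharibianLegall2022, §2.1 Definition 3] -/
structure ZetaSampling (ζ : ℝ) (v : Fin n → ℝ) where
  /-- the distribution the sampler `𝒮𝒬_v` draws from -/
  p : Fin n → ℝ
  p_nonneg : ∀ j, 0 ≤ p j
  sum_p : ∑ j, p j = 1
  /-- (ii), lower end of the interval -/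
  lower : ∀ j, (1 - ζ) * lengthSqDist v j ≤ p j
  /-- (ii), upper end of the interval -/
  upper : ∀ j, p j ≤ (1 + ζ) * lengthSqDist v j
  /-- (iii), the norm estimate -/
  m : ℝ
  abs_m_sub_le : |m - Real.sqrt (normSq v)| ≤ ζ * Real.sqrt (normSq v)

namespace ZetaSampling

variable {ζ : ℝ} {v : Fin n → ℝ}

/-- `ζ = 0`: ordinary sampling-access, `p = 𝒟_v`, `m = ‖v‖` ("for `ζ = 0` we obtain the same notion of
sampling-access as in prior works"). [cite: GharibianLegall2022, §2.1 Definition 3] -/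
def exact (hv : v ≠ 0) : ZetaSampling 0 v where
  p := lengthSqDist v
  p_nonneg := lengthSqDist_nonneg v
  sum_p := sum_lengthSqDist hv
  lower j := by simp
  upper j := by simp
  m := Real.sqrt (normSq v)
  abs_m_sub_le := by simp

/-- Bridge to CGLLTW's oversampling (Def. 2.7): a `ζ`-sampling distribution is
`(1/(1−ζ))`-oversampled ("[Chia+STOC20] also considered a slighly [sic] different generalization,
which was called `φ`-oversampling"). [cite: GharibianLegall2022, §2.1, before Definition 3];
[cite: ChiaEtAl2022, Def. 2.7] -/
theorem isOversampledDist (S : ZetaSampling ζ v) :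
    IsOversampledDist (1 / (1 - ζ)) v S.p := by
  refine ⟨S.p_nonneg, S.sum_p, fun j => ?_⟩
  rw [div_div_eq_mul_div, div_one, mul_comm]
  exact S.lower j

/-- Zero entries carry no sampling weight: `v_j = 0 ⇒ p(j) = 0` (upper end of (ii)).
[cite: GharibianLegall2022, §2.1 Definition 3 (ii)] -/
theorem p_eq_zero (S : ZetaSampling ζ v) {j : Fin n} (hj : v j = 0) : S.p j = 0 := by
  have h : S.p j ≤ (1 + ζ) * (v j ^ 2 / normSq v) := S.upper j
  rw [hj] at h
  simp only [ne_eq, OfNat.ofNat_ne_zero, not_false_eq_true, zero_pow, zero_div, mul_zero] at h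
  exact le_antisymm h (S.p_nonneg j)

/-- (iii) upper end: `m ≤ (1+ζ)‖v‖`. [cite: GharibianLegall2022, §2.1 Definition 3 (iii)] -/
theorem m_le (S : ZetaSampling ζ v) : S.m ≤ (1 + ζ) * Real.sqrt (normSq v) := by
  have := (abs_sub_le_iff.1 S.abs_m_sub_le).1
  linarith

/-- (iii) lower end: `(1−ζ)‖v‖ ≤ m`. [cite: GharibianLegall2022, §2.1 Definition 3 (iii)] -/
theorem le_m (S : ZetaSampling ζ v) : (1 - ζ) * Real.sqrt (normSq v) ≤ S.m := by
  have := (abs_sub_le_iff.1 S.abs_m_sub_le).2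
  linarith

/-- `m² ≤ (1+ζ)²‖v‖²` ("`m ∈ [(1−ζ)‖v‖, (1+ζ)‖v‖]`"). [cite: GharibianLegall2022, §4.1, proof of
Theorem 3 (formal statement)] -/
theorem m_sq_le (S : ZetaSampling ζ v) : S.m ^ 2 ≤ (1 + ζ) ^ 2 * normSq v := by
  have hs : 0 ≤ Real.sqrt (normSq v) := Real.sqrt_nonneg _
  have h1 := S.m_le
  have h2 := S.le_m
  have hlow : -((1 + ζ) * Real.sqrt (normSq v)) ≤ S.m := by nlinarith
  have hab : |S.m| ≤ (1 + ζ) * Real.sqrt (normSq v) := abs_le.2 ⟨hlow, h1⟩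
  calc S.m ^ 2 = |S.m| ^ 2 := (sq_abs _).symm
    _ ≤ ((1 + ζ) * Real.sqrt (normSq v)) ^ 2 := pow_le_pow_left₀ (abs_nonneg _) hab 2
    _ = (1 + ζ) ^ 2 * normSq v := by rw [mul_pow, Real.sq_sqrt (normSq_nonneg v)]

/-- `(1−ζ)²‖v‖² ≤ m²` (for `ζ ≤ 1`). [cite: GharibianLegall2022, §4.1, proof of Theorem 3 (formal
statement)] -/
theorem le_m_sq (S : ZetaSampling ζ v) (h1 : ζ ≤ 1) : (1 - ζ) ^ 2 * normSq v ≤ S.m ^ 2 := by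
  have hs : 0 ≤ Real.sqrt (normSq v) := Real.sqrt_nonneg _
  have h0 : 0 ≤ (1 - ζ) * Real.sqrt (normSq v) := mul_nonneg (by linarith) hs
  calc (1 - ζ) ^ 2 * normSq v = ((1 - ζ) * Real.sqrt (normSq v)) ^ 2 := by
        rw [mul_pow, Real.sq_sqrt (normSq_nonneg v)]
    _ ≤ S.m ^ 2 := pow_le_pow_left₀ h0 S.le_m 2

/-- `(1+ζ)³ ≤ 1+7ζ` on `[0,1]`. [cite: GharibianLegall2022, §4.1, proof of Theorem 3 (formal
statement) ("`(1+ζ)³|v_i|² ≤ (1+7ζ)|v_i|²`")] -/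
private theorem one_add_pow_three_le (h0 : 0 ≤ ζ) (h1 : ζ ≤ 1) : (1 + ζ) ^ 3 ≤ 1 + 7 * ζ := by
  nlinarith [mul_nonneg h0 h0, mul_nonneg (mul_nonneg h0 h0) h0, mul_nonneg (mul_nonneg h0 h0) (sub_nonneg.2 h1)]

/-- `1−4ζ ≤ (1−ζ)³` on `[0,1]`. [cite: GharibianLegall2022, §4.1, proof of Theorem 3 (formal
statement) ("`(1−ζ)³|v_i|² ≥ (1−4ζ)|v_i|²`")] -/
private theorem one_sub_four_mul_le (h0 : 0 ≤ ζ) (h1 : ζ ≤ 1) : 1 - 4 * ζ ≤ (1 - ζ) ^ 3 := by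
  nlinarith [mul_nonneg h0 h0, mul_nonneg (mul_nonneg h0 h0) h0, mul_nonneg (mul_nonneg h0 h0) (sub_nonneg.2 h1)]

/-- **First printed inequality**: `m² p(i) ≤ (1+ζ)³|v_i|² ≤ (1+7ζ)|v_i|²`, `ζ ∈ [0,1]`.
[cite: GharibianLegall2022, §4.1, proof of Theorem 3 (formal statement)
("Note that the inequalities `m²p(i) ≤ (1+ζ)³|v_i|² ≤ (1+7ζ)|v_i|²` … hold")] -/
theorem m_sq_mul_p_le (S : ZetaSampling ζ v) (h0 : 0 ≤ ζ) (h1 : ζ ≤ 1) (j : Fin n) :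
    S.m ^ 2 * S.p j ≤ (1 + 7 * ζ) * v j ^ 2 := by
  by_cases hv : normSq v = 0
  · have hvj : v j = 0 := by
      have := (normSq_eq_zero_iff v).1 hv
      simp [this]
    rw [S.p_eq_zero hvj, hvj]
    simp
  · have hN : 0 < normSq v := lt_of_le_of_ne (normSq_nonneg v) (Ne.symm hv)
    calc S.m ^ 2 * S.p j ≤ ((1 + ζ) ^ 2 * normSq v) * ((1 + ζ) * lengthSqDist v j) :=
          mul_le_mul S.m_sq_le (S.upper j) (S.p_nonneg j) (by positivity)
      _ = (1 + ζ) ^ 3 * v j ^ 2 := by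
          unfold lengthSqDist
          field_simp
      _ ≤ (1 + 7 * ζ) * v j ^ 2 :=
          mul_le_mul_of_nonneg_right (one_add_pow_three_le h0 h1) (sq_nonneg _)

/-- **Second printed inequality**: `m² p(i) ≥ (1−ζ)³|v_i|² ≥ (1−4ζ)|v_i|²`, `ζ ∈ [0,1]`.
[cite: GharibianLegall2022, §4.1, proof of Theorem 3 (formal statement)
("`m²p(i) ≥ (1−ζ)³|v_i|² ≥ (1−4ζ)|v_i|²`")] -/
theorem le_m_sq_mul_p (S : ZetaSampling ζ v) (h0 : 0 ≤ ζ) (h1 : ζ ≤ 1) (j : Fin n) :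
    (1 - 4 * ζ) * v j ^ 2 ≤ S.m ^ 2 * S.p j := by
  by_cases hv : normSq v = 0
  · have hvj : v j = 0 := by
      have := (normSq_eq_zero_iff v).1 hv
      simp [this]
    rw [hvj]
    simpa using mul_nonneg (sq_nonneg S.m) (S.p_nonneg j)
  · have hN : 0 < normSq v := lt_of_le_of_ne (normSq_nonneg v) (Ne.symm hv)
    calc (1 - 4 * ζ) * v j ^ 2 ≤ (1 - ζ) ^ 3 * v j ^ 2 :=
          mul_le_mul_of_nonneg_right (one_sub_four_mul_le h0 h1) (sq_nonneg _)
      _ = ((1 - ζ) ^ 2 * normSq v) * ((1 - ζ) * lengthSqDist v j) := by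
          unfold lengthSqDist
          field_simp
      _ ≤ S.m ^ 2 * S.p j :=
          mul_le_mul (S.le_m_sq h1) (S.lower j)
            (mul_nonneg (by linarith) (lengthSqDist_nonneg v j)) (sq_nonneg _)

/-- Hence `|m² p(i) − |v_i|²| ≤ 7ζ|v_i|²` (the step "`≤ 7ζ ∑_i |w_i||v_i|`").
[cite: GharibianLegall2022, §4.1, proof of Theorem 3 (formal statement)] -/
theorem abs_m_sq_mul_p_sub_le (S : ZetaSampling ζ v) (h0 : 0 ≤ ζ) (h1 : ζ ≤ 1) (j : Fin n) :
    |S.m ^ 2 * S.p j - v j ^ 2| ≤ 7 * ζ * v j ^ 2 := by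
  rw [abs_sub_le_iff]
  constructor
  · have := S.m_sq_mul_p_le h0 h1 j
    linarith
  · have := S.le_m_sq_mul_p h0 h1 j
    nlinarith [sq_nonneg (v j)]

/-! ### The estimator `X = w_j m² / v_j` and its two moments -/

/-- **GL22's single-sample estimator**: "1. sample one index `j`; 2. query `v_j`; 3. compute `w_j`
(Lemma 3); 4. output `w_j m²/v_j`" (real case; junk value `0` when `v_j = 0`, an index of
`p`-weight `0` by `p_eq_zero`). [cite: GharibianLegall2022, §4.1, proof of Theorem 3 (formal
statement), steps 1–4] -/
def est (S : ZetaSampling ζ v) (w : Fin n → ℝ) (j : Fin n) : ℝ := w j * S.m ^ 2 / v j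

/-- Term-wise bias: `|p(j) X_j − v_j w_j| = |w_j/v_j| · |m²p(j) − v_j²| ≤ 7ζ |w_j||v_j|`.
[cite: GharibianLegall2022, §4.1, proof of Theorem 3 (formal statement)
("`|E[X] − v†P(√(A†A))u| = |∑_i (w_i/v_i)(m²p(i) − |v_i|²)| ≤ … ≤ 7ζ∑_i|w_i||v_i|`")] -/
theorem abs_p_mul_est_sub_le (S : ZetaSampling ζ v) (h0 : 0 ≤ ζ) (h1 : ζ ≤ 1) (w : Fin n → ℝ)
    (j : Fin n) : |S.p j * S.est w j - v j * w j| ≤ 7 * ζ * (|w j| * |v j|) := by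
  by_cases hvj : v j = 0
  · rw [S.p_eq_zero hvj, hvj]
    simp
  · have key : S.p j * S.est w j - v j * w j = (w j / v j) * (S.m ^ 2 * S.p j - v j ^ 2) := by
      unfold est
      field_simp
    rw [key, abs_mul, abs_div]
    have hne : |v j| ≠ 0 := abs_ne_zero.2 hvj
    have hvv : v j ^ 2 = |v j| * |v j| := by rw [← sq, sq_abs]
    calc |w j| / |v j| * |S.m ^ 2 * S.p j - v j ^ 2| ≤ |w j| / |v j| * (7 * ζ * v j ^ 2) :=
          mul_le_mul_of_nonneg_left (S.abs_m_sq_mul_p_sub_le h0 h1 j) (by positivity)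
      _ = 7 * ζ * (|w j| * |v j|) := by
          rw [hvv]
          field_simp

/-- **Bias of the estimator**: `|E[X] − ⟨v, w⟩| ≤ 7ζ ∑_i|w_i||v_i| ≤ 7ζ‖w‖‖v‖`.
[cite: GharibianLegall2022, §4.1, proof of Theorem 3 (formal statement)
("`≤ 7ζ∑|w_i||v_i| ≤ 7ζ‖w‖‖v‖`")] -/
theorem abs_mean_est_sub_le (S : ZetaSampling ζ v) (h0 : 0 ≤ ζ) (h1 : ζ ≤ 1) (w : Fin n → ℝ) :
    |∑ j, S.p j * S.est w j - ∑ j, v j * w j|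
      ≤ 7 * ζ * (Real.sqrt (normSq w) * Real.sqrt (normSq v)) := by
  rw [← Finset.sum_sub_distrib]
  calc |∑ j, (S.p j * S.est w j - v j * w j)| ≤ ∑ j, |S.p j * S.est w j - v j * w j| :=
        abs_sum_le_sum_abs _ _
    _ ≤ ∑ j, 7 * ζ * (|w j| * |v j|) := sum_le_sum fun j _ => S.abs_p_mul_est_sub_le h0 h1 w j
    _ = 7 * ζ * ∑ j, |w j| * |v j| := by rw [← mul_sum]
    _ ≤ 7 * ζ * (Real.sqrt (normSq w) * Real.sqrt (normSq v)) := by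
        refine mul_le_mul_of_nonneg_left ?_ (by positivity)
        have h := Real.sum_mul_le_sqrt_mul_sqrt Finset.univ (fun j => |w j|) (fun j => |v j|)
        simpa [normSq, sq_abs] using h

/-- Term-wise second moment: `p(j) X_j² = w_j² m² · (m²p(j)/v_j²) ≤ (1+7ζ) m² w_j²`.
[cite: GharibianLegall2022, §4.1, proof of Theorem 3 (formal statement)
("`Var[ℜ(X)] ≤ … ≤ ∑_i (|w_i|m²/|v_i|)² p(i) ≤ (1+7ζ)∑_i|w_i|²m²`")] -/
theorem p_mul_est_sq_le (S : ZetaSampling ζ v) (h0 : 0 ≤ ζ) (h1 : ζ ≤ 1) (w : Fin n → ℝ)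
    (j : Fin n) : S.p j * S.est w j ^ 2 ≤ (1 + 7 * ζ) * S.m ^ 2 * w j ^ 2 := by
  by_cases hvj : v j = 0
  · rw [S.p_eq_zero hvj, zero_mul]
    have : 0 ≤ 1 + 7 * ζ := by linarith
    positivity
  · have key : S.p j * S.est w j ^ 2 = w j ^ 2 * S.m ^ 2 * (S.m ^ 2 * S.p j / v j ^ 2) := by
      unfold est
      field_simp
    rw [key]
    have hb : S.m ^ 2 * S.p j / v j ^ 2 ≤ 1 + 7 * ζ := by
      rw [div_le_iff₀ (by positivity)]
      exact S.m_sq_mul_p_le h0 h1 j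
    calc w j ^ 2 * S.m ^ 2 * (S.m ^ 2 * S.p j / v j ^ 2) ≤ w j ^ 2 * S.m ^ 2 * (1 + 7 * ζ) :=
          mul_le_mul_of_nonneg_left hb (by positivity)
      _ = (1 + 7 * ζ) * S.m ^ 2 * w j ^ 2 := by ring

/-- **Second moment of the estimator**: `E[X²] ≤ (1+7ζ) m² ‖w‖² ≤ (1+7ζ)(1+ζ)² ‖w‖²‖v‖²`.
[cite: GharibianLegall2022, §4.1, proof of Theorem 3 (formal statement)
("`≤ (1+7ζ)∑_i|w_i|²m² ≤ (1+7ζ)(1+ζ)²‖w‖²‖v‖²`")] -/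
theorem mean_est_sq_le (S : ZetaSampling ζ v) (h0 : 0 ≤ ζ) (h1 : ζ ≤ 1) (w : Fin n → ℝ) :
    ∑ j, S.p j * S.est w j ^ 2 ≤ (1 + 7 * ζ) * (1 + ζ) ^ 2 * normSq w * normSq v := by
  have h7 : 0 ≤ 1 + 7 * ζ := by linarith
  calc ∑ j, S.p j * S.est w j ^ 2 ≤ ∑ j, (1 + 7 * ζ) * S.m ^ 2 * w j ^ 2 :=
        sum_le_sum fun j _ => S.p_mul_est_sq_le h0 h1 w j
    _ = (1 + 7 * ζ) * S.m ^ 2 * normSq w := by rw [← mul_sum]; rfl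
    _ ≤ (1 + 7 * ζ) * ((1 + ζ) ^ 2 * normSq v) * normSq w :=
        mul_le_mul_of_nonneg_right (mul_le_mul_of_nonneg_left S.m_sq_le h7) (normSq_nonneg w)
    _ = (1 + 7 * ζ) * (1 + ζ) ^ 2 * normSq w * normSq v := by ring

end ZetaSampling

/-! ### Means of `r` copies, Chebyshev, and the powering lemma -/

/-- The mean `Z = (X_1 + ⋯ + X_r)/r` of one block of `r` independent samples `β : Fin r → [N]`.
[cite: GharibianLegall2022, §4.1, proof of Theorem 3 (formal statement) ("Apply the above procedure
`r` times … and output the mean")] -/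
def blockMean (Z : Fin n → ℝ) {x : ℕ} (β : Fin x → Fin n) : ℝ := (∑ t, Z (β t)) / x

/-- **Chebyshev for a biased estimator.** For a probability vector `p`, values `Z` with
`|E_p Z − μ| ≤ b` and `E_p Z² ≤ M`, the `p^x`-mass of the blocks whose mean is off from `μ` by `≥ ε`
(`ε > b`) is at most `M/(x(ε−b)²)`: `Var[Z̄] = Var[Z]/x ≤ M/x` and
`Pr[|Z̄ − μ| ≥ ε] ≤ Pr[|Z̄ − E Z̄| ≥ ε − b]`.
[cite: GharibianLegall2022, §4.1, proof of Theorem 3 (formal statement) ("Since the variables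
`X_1,…,X_r` are independent, … `Var[ℜ(Z)] = Var[ℜ(X)]/r`"; "By Chebyshev's inequality …";
"`Pr[|Z − v†P(√(A†A))u| ≤ ε] ≥ Pr[|Z − E[X]| ≤ ε − 7ζ]`")] -/
theorem blockMean_far_mass_le_of_bias {p : Fin n → ℝ} (hp0 : ∀ j, 0 ≤ p j) (hp1 : ∑ j, p j = 1)
    (Z : Fin n → ℝ) {μ b M : ℝ} (hbias : |∑ j, p j * Z j - μ| ≤ b) (hM : ∑ j, p j * Z j ^ 2 ≤ M)
    {x : ℕ} (hx : 0 < x) {ε : ℝ} (hbε : b < ε) :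
    ∑ β ∈ univ.filter (fun β : Fin x → Fin n => ε ≤ |blockMean Z β - μ|), iidWeight p β
      ≤ M / (x * (ε - b) ^ 2) := by
  classical
  set μ' := ∑ j, p j * Z j with hμ'
  have ht : 0 < ε - b := sub_pos.2 hbε
  -- variance of the block mean about the true mean μ'
  have hvar : ∑ β : Fin x → Fin n, iidWeight p β * (blockMean Z β - μ') ^ 2 ≤ M / x := by
    have e := sum_iidWeight_mul_sq_avg_sub hp1 Z hx.ne'
    rw [sum_mul_sq_sub_mean hp1 Z] at e
    have hdef : ∑ β : Fin x → Fin n, iidWeight p β * (blockMean Z β - μ') ^ 2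
        = ∑ β : Fin x → Fin n, iidWeight p β * ((∑ t, Z (β t)) / x - μ') ^ 2 := rfl
    rw [hdef, e]
    exact div_le_div_of_nonneg_right (by nlinarith [sq_nonneg μ']) (Nat.cast_nonneg _)
  -- Markov on (Z̄ − μ')² at level (ε − b)²
  have hmk := mul_sum_filter_le_sum_mul (fun β : Fin x → Fin n => iidWeight p β)
    (fun β => (blockMean Z β - μ') ^ 2) (iidWeight_nonneg hp0) (fun β => sq_nonneg _)
    ((ε - b) ^ 2)
  -- the event |Z̄ − μ| ≥ ε is contained in (ε − b)² ≤ (Z̄ − μ')²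
  have hsub : (univ.filter fun β : Fin x → Fin n => ε ≤ |blockMean Z β - μ|)
      ⊆ (univ.filter fun β : Fin x → Fin n => (ε - b) ^ 2 ≤ (blockMean Z β - μ') ^ 2) := by
    intro β hβ
    simp only [Finset.mem_filter, Finset.mem_univ, true_and] at hβ ⊢
    have htri : |blockMean Z β - μ| ≤ |blockMean Z β - μ'| + |μ' - μ| := by
      have := abs_sub_le (blockMean Z β) μ' μ
      simpa using this
    have hfar : ε - b ≤ |blockMean Z β - μ'| := by linarith
    rw [← sq_abs (blockMean Z β - μ')]
    exact pow_le_pow_left₀ ht.le hfar 2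
  calc ∑ β ∈ univ.filter (fun β : Fin x → Fin n => ε ≤ |blockMean Z β - μ|), iidWeight p β
      ≤ ∑ β ∈ univ.filter (fun β : Fin x → Fin n => (ε - b) ^ 2 ≤ (blockMean Z β - μ') ^ 2),
          iidWeight p β :=
        sum_le_sum_of_subset_of_nonneg hsub fun β _ _ => iidWeight_nonneg hp0 β
    _ ≤ (∑ β, iidWeight p β * (blockMean Z β - μ') ^ 2) / (ε - b) ^ 2 := by
        rw [le_div_iff₀ (by positivity), mul_comm]
        exact hmk
    _ ≤ (M / x) / (ε - b) ^ 2 := div_le_div_of_nonneg_right hvar (by positivity)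
    _ = M / (x * (ε - b) ^ 2) := by rw [div_div]

namespace ZetaSampling

variable {ζ : ℝ} {v : Fin n → ℝ}

/-- **"Probability at least 3/4" with an explicit `r = Θ(1/ε²)`.** For `‖v‖, ‖w‖ ≤ 1`,
`0 ≤ ζ ≤ ε/8`, `ε ≤ 1`: the bias is `≤ 7ζ ≤ 7ε/8`, the second moment is `≤ (1+7ζ)(1+ζ)² ≤ 4`, so a
block of `r ≥ 1024/ε²` samples has its mean off by `≥ ε` with `p^r`-mass `≤ 4/(r(ε/8)²) ≤ 1/4`.
(The paper writes "taking `r = Θ(1/ε²)` guarantees … probability at least `3/4`"; the constant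
`1024` is one admissible choice, ours.) [cite: GharibianLegall2022, §4.1, proof of Theorem 3
(formal statement) ("For `ζ ≤ ε/8`, taking `r = Θ(1/ε²)` guarantees that the estimate is an
`ε`-additive-approximation … with probability at least `3/4`")] -/
theorem blockMean_est_far_mass_le_quarter (S : ZetaSampling ζ v) (w : Fin n → ℝ) (h0 : 0 ≤ ζ)
    {ε : ℝ} (hε : 0 < ε) (hε1 : ε ≤ 1) (hζ : ζ ≤ ε / 8) (hv : normSq v ≤ 1) (hw : normSq w ≤ 1)
    {x : ℕ} (hx : 1024 / ε ^ 2 ≤ (x : ℝ)) :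
    ∑ β ∈ univ.filter (fun β : Fin x → Fin n => ε ≤ |blockMean (S.est w) β - ∑ j, v j * w j|),
        iidWeight S.p β ≤ 1 / 4 := by
  have h1 : ζ ≤ 1 := by linarith
  have hsw : Real.sqrt (normSq w) ≤ 1 := Real.sqrt_le_one.mpr hw  |>.trans_eq rfl
  have hsv : Real.sqrt (normSq v) ≤ 1 := Real.sqrt_le_one.mpr hv
  have hbias : |∑ j, S.p j * S.est w j - ∑ j, v j * w j| ≤ 7 * ζ := by
    refine (S.abs_mean_est_sub_le h0 h1 w).trans ?_
    have : Real.sqrt (normSq w) * Real.sqrt (normSq v) ≤ 1 := by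
      calc Real.sqrt (normSq w) * Real.sqrt (normSq v) ≤ 1 * 1 :=
            mul_le_mul hsw hsv (Real.sqrt_nonneg _) zero_le_one
        _ = 1 := one_mul 1
    nlinarith
  have hM : ∑ j, S.p j * S.est w j ^ 2 ≤ 4 := by
    refine (S.mean_est_sq_le h0 h1 w).trans ?_
    have hz8 : ζ ≤ 1 / 8 := by linarith
    have hc : (1 + 7 * ζ) * (1 + ζ) ^ 2 ≤ 4 := by
      nlinarith [mul_nonneg h0 h0, mul_nonneg (mul_nonneg h0 h0) h0]
    have hwv : normSq w * normSq v ≤ 1 := by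
      calc normSq w * normSq v ≤ 1 * 1 := mul_le_mul hw hv (normSq_nonneg _) zero_le_one
        _ = 1 := one_mul 1
    have h7 : 0 ≤ (1 + 7 * ζ) * (1 + ζ) ^ 2 := by positivity
    calc (1 + 7 * ζ) * (1 + ζ) ^ 2 * normSq w * normSq v
        = ((1 + 7 * ζ) * (1 + ζ) ^ 2) * (normSq w * normSq v) := by ring
      _ ≤ 4 * 1 := mul_le_mul hc hwv (mul_nonneg (normSq_nonneg _) (normSq_nonneg _)) (by norm_num)
      _ = 4 := by norm_num
  have hxpos : (0 : ℝ) < x := lt_of_lt_of_le (by positivity) hx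
  have hx0 : 0 < x := Nat.cast_pos.1 hxpos
  have hbε : 7 * ζ < ε := by linarith
  have h := blockMean_far_mass_le_of_bias S.p_nonneg S.sum_p (S.est w) hbias hM hx0 hbε
  refine h.trans ?_
  -- 4/(x(ε−7ζ)²) ≤ 4/(x(ε/8)²) = 256/(xε²) ≤ 1/4
  have hgap : ε / 8 ≤ ε - 7 * ζ := by linarith
  have hden : (x : ℝ) * (ε / 8) ^ 2 ≤ x * (ε - 7 * ζ) ^ 2 :=
    mul_le_mul_of_nonneg_left (pow_le_pow_left₀ (by positivity) hgap 2) hxpos.le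
  calc 4 / ((x : ℝ) * (ε - 7 * ζ) ^ 2) ≤ 4 / (x * (ε / 8) ^ 2) :=
        div_le_div_of_nonneg_left (by norm_num) (by positivity) hden
    _ ≤ 1 / 4 := by
        rw [div_le_div_iff₀ (by positivity) (by norm_num)]
        have : 1024 ≤ (x : ℝ) * ε ^ 2 := by
          have := (div_le_iff₀ (by positivity : (0 : ℝ) < ε ^ 2)).1 hx
          linarith
        nlinarith

/-- **GL22 Theorem 3 (formal statement, §4.1) — the estimation half, real case.**  Given query
access to `w ∈ ℝᴺ` (in the paper `w = P(√(A†A))u`, its entries supplied by Lemma 3) and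
`ζ`-sampling-access to `v ∈ ℝᴺ` with `‖v‖, ‖w‖ ≤ 1`, `0 ≤ ζ ≤ ε/8`, `ε ≤ 1`: draw `q` blocks of
`r` independent indices from `p` (`ω : Fin q → Fin r → [N]`, weight `∏_i ∏_t p(ω i t)`), form the
block means of `X = w_j m²/v_j`, output ANY median of the `q` block means.  If `r ≥ 1024/ε²` and
`q ≥ 8 ln(1/δ)`, the outcomes whose output is off from `⟨v,w⟩ = v†w` by `≥ ε` have total weight
`≤ δ` — `r·q = O(ε⁻² log(1/δ))` samples (the paper: probability `≥ 1 − 1/poly(N)` from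
`O(log N)` repetitions via the powering lemma, i.e. `δ = 1/poly(N)`).
[cite: GharibianLegall2022, §4.1 Theorem 3 (formal statement: "`EST(s,ε,ζ)` can be solved
classically with probability at least `1 − 1/poly(N)` in `Õ(s^{2d}/ε²)` time for any `ζ ≤ ε/8`")
and its proof; §2 Lemma 1 (= [JerrumValiantVazirani1986, Lemma 6.1], the powering lemma)] -/
theorem estimation (S : ZetaSampling ζ v) (w : Fin n → ℝ) (h0 : 0 ≤ ζ) {ε δ : ℝ} (hε : 0 < ε)
    (hε1 : ε ≤ 1) (hζ : ζ ≤ ε / 8) (hδ : 0 < δ) (hv : normSq v ≤ 1) (hw : normSq w ≤ 1)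
    {x q : ℕ} (hx : 1024 / ε ^ 2 ≤ (x : ℝ)) (hq : 0 < q) (hqδ : 8 * Real.log (1 / δ) ≤ q)
    (med : (Fin q → Fin x → Fin n) → ℝ)
    (hmed : ∀ ω, IsMedian (fun i => blockMean (S.est w) (ω i)) (med ω)) :
    ∑ ω ∈ univ.filter (fun ω : Fin q → Fin x → Fin n => ε ≤ |med ω - ∑ j, v j * w j|),
        ∏ i, iidWeight S.p (ω i) ≤ δ := by
  classical
  have hbad := S.blockMean_est_far_mass_le_quarter w h0 hε hε1 hζ hv hw hx
  have h := sum_weight_median_far_le_exp (fun β : Fin x → Fin n => iidWeight S.p β)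
    (iidWeight_nonneg S.p_nonneg) (sum_iidWeight S.sum_p) (fun β => blockMean (S.est w) β)
    (∑ j, v j * w j) ε hbad hq med hmed
  exact h.trans (exp_neg_div_eight_le hδ hqδ)

/-- The same with a median selector supplied by `exists_isMedian` (the procedure is well defined on
every outcome). [cite: GharibianLegall2022, §4.1 Theorem 3 (formal statement); §2 Lemma 1] -/
theorem estimation_exists_median (S : ZetaSampling ζ v) (w : Fin n → ℝ) (h0 : 0 ≤ ζ) {ε δ : ℝ}
    (hε : 0 < ε) (hε1 : ε ≤ 1) (hζ : ζ ≤ ε / 8) (hδ : 0 < δ) (hv : normSq v ≤ 1)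
    (hw : normSq w ≤ 1) {x q : ℕ} (hx : 1024 / ε ^ 2 ≤ (x : ℝ)) (hq : 0 < q)
    (hqδ : 8 * Real.log (1 / δ) ≤ q) :
    ∃ med : (Fin q → Fin x → Fin n) → ℝ,
      (∀ ω, IsMedian (fun i => blockMean (S.est w) (ω i)) (med ω)) ∧
      ∑ ω ∈ univ.filter (fun ω : Fin q → Fin x → Fin n => ε ≤ |med ω - ∑ j, v j * w j|),
        ∏ i, iidWeight S.p (ω i) ≤ δ := by
  classical
  have hsel : ∀ ω : Fin q → Fin x → Fin n, ∃ c, IsMedian (fun i => blockMean (S.est w) (ω i)) c :=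
    fun ω => by
      obtain ⟨i, hi⟩ := exists_isMedian hq (fun i => blockMean (S.est w) (ω i))
      exact ⟨_, hi⟩
  choose med hmed using hsel
  exact ⟨med, hmed, S.estimation w h0 hε hε1 hζ hδ hv hw hx hq hqδ med hmed⟩

end ZetaSampling

/-! ### Theorem 3 with Lemma 3 plugged in: `EST(s, ε, ζ)` for `v† P(√(A†A)) u` -/

/-- **GL22 Theorem 3 (formal statement), the algorithm as printed, real case.**  Input: the two
Def.-2 oracles of an `M × N` real matrix `A` with `s`-sparse rows and columns, query access to
`u ∈ ℝᴺ`, `ζ`-sampling-access to `v ∈ ℝᴺ`, an even polynomial `P(x) = ∑_{k≤d} a_k x^{2k}`;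
write `w = P(√(AᵀA))u` and assume `‖v‖ ≤ 1`, `‖w‖ ≤ 1` (in the paper `‖w‖ ≤ 1` follows from
`‖A‖ ≤ 1`, `‖u‖ ≤ 1`, `|P| ≤ 1` on `[−1,1]` through the SVD, eq. (3) — that spectral step is not
re-derived here and is kept as the hypothesis `hw`).  The procedure samples `j ∼ p`, computes
`w_j` BY THE RECURSION OF LEMMA 3 on the Gram oracle (`recEvalPoly`, `≤ ∑_{k≤d} s^{2k}` queries to
`u` per entry), outputs `w_j m²/v_j`, averages `r ≥ 1024/ε²` of these and takes a median of
`q ≥ 8 ln(1/δ)` averages: the output is within `ε` of `vᵀP(√(AᵀA))u` except on outcomes of weight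
`≤ δ`.  Total queries to `u`: `≤ r·q·∑_{k≤d} s^{2k} = Õ(s^{2d}/ε²)·log(1/δ)`, as printed.
[cite: GharibianLegall2022, §4.1 Theorem 3 (formal statement) and its proof (steps 1–4, "Compute
the value `w_j` using the algorithm of Lemma 3"), Lemma 3] -/
theorem sparseQSVT_estimation {M N d s : ℕ} (A : Matrix (Fin M) (Fin N) ℝ) (a : Fin (d + 1) → ℝ)
    (u : Fin N → ℝ) {rowO : SparseQuery.RowOracle (Fin M) (Fin N) ℝ}
    {colO : SparseQuery.RowOracle (Fin N) (Fin M) ℝ} (hr : rowO.Lists A) (hc : colO.Lists Aᵀ)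
    (hrw : rowO.Width s) (hcw : colO.Width s) {ζ : ℝ} {v : Fin N → ℝ} (S : ZetaSampling ζ v)
    (h0 : 0 ≤ ζ) {ε δ : ℝ} (hε : 0 < ε) (hε1 : ε ≤ 1) (hζ : ζ ≤ ε / 8) (hδ : 0 < δ)
    (hv : normSq v ≤ 1) (hw : normSq (SparseQuery.evenPolyApply a A u) ≤ 1) {x q : ℕ}
    (hx : 1024 / ε ^ 2 ≤ (x : ℝ)) (hq : 0 < q) (hqδ : 8 * Real.log (1 / δ) ≤ q)
    (med : (Fin q → Fin x → Fin N) → ℝ)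
    (hmed : ∀ ω, IsMedian
      (fun i => blockMean (S.est (SparseQuery.recEvalPoly a (rowO.gram colO) u)) (ω i)) (med ω)) :
    (∑ ω ∈ univ.filter (fun ω : Fin q → Fin x → Fin N =>
        ε ≤ |med ω - ∑ j, v j * SparseQuery.evenPolyApply a A u j|), ∏ i, iidWeight S.p (ω i) ≤ δ)
    ∧ ∀ j, SparseQuery.leafQueriesPoly d (rowO.gram colO) j ≤ ∑ k : Fin (d + 1), s ^ (2 * (k : ℕ)) := by
  have hG : (rowO.gram colO).Represents (Aᴴ * A) := SparseQuery.RowOracle.gram_represents hr.represents hc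
  have hfun : SparseQuery.recEvalPoly a (rowO.gram colO) u = SparseQuery.evenPolyApply a A u :=
    funext fun i => SparseQuery.recEvalPoly_eq hG u i
  refine ⟨?_, fun j => SparseQuery.leafQueriesPoly_le (SparseQuery.RowOracle.gram_width hrw hcw) j⟩
  rw [hfun] at hmed
  exact S.estimation _ h0 hε hε1 hζ hδ hv hw hx hq hqδ med hmed

/-! ### The spectral step: `‖P(√(A†A))u‖ ≤ ‖u‖` (eq. (3)), and Theorem 3 with the printed hypotheses -/

section spectral

variable {M N : ℕ}

/-- `‖v‖² = v ⬝ᵥ v`. [folklore] -/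
private theorem normSq_eq_dotProduct (v : Fin N → ℝ) : normSq v = v ⬝ᵥ v := by
  simp [normSq, dotProduct, sq]

/-- A real matrix with `UᵀU = 1` preserves `‖·‖²`. [folklore] -/
private theorem normSq_mulVec_of_transpose_mul_self {U : Matrix (Fin N) (Fin N) ℝ}
    (hU : Uᵀ * U = 1) (x : Fin N → ℝ) : normSq (U *ᵥ x) = normSq x := by
  rw [normSq_eq_dotProduct, normSq_eq_dotProduct, dotProduct_mulVec, ← vecMul_transpose,
    vecMul_vecMul, hU, vecMul_one]

/-- `‖diagonal(q) z‖² = ∑ q_j² z_j² ≤ ‖z‖²` when `|q_j| ≤ 1`. [folklore] -/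
private theorem normSq_diagonal_mulVec_le {q : Fin N → ℝ} (hq : ∀ j, |q j| ≤ 1) (z : Fin N → ℝ) :
    normSq (diagonal q *ᵥ z) ≤ normSq z := by
  unfold normSq
  refine sum_le_sum fun j _ => ?_
  rw [mulVec_diagonal, mul_pow]
  have h1 : q j ^ 2 ≤ 1 := by
    have := hq j
    rw [← sq_abs]
    nlinarith [abs_nonneg (q j)]
  nlinarith [sq_nonneg (z j)]

/-- **The spectral step of GL22 §4.1** (`‖P(√(A†A))u‖ ≤ ‖u‖`): for a real `M × N` matrix with
`‖A‖ ≤ 1` (i.e. `‖Ax‖ ≤ ‖x‖` for all `x`) and an even polynomial `P(x) = ∑_{k≤d} a_k x^{2k}` with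
`|P(x)| ≤ 1` on `[−1,1]`, `‖P(√(AᵀA))u‖² ≤ ‖u‖²`.  Printed as the one-line consequence
`‖w‖ ≤ ‖P(√(A†A))‖‖u‖ ≤ 1` of the singular value decomposition
`P(√(A†A)) = ∑_i P(σ_i) v_i v_i†` (eq. (3)); proved here through Mathlib's spectral theorem for the
real symmetric matrix `AᵀA` (eigenvalues `λ_i = σ_i² = ‖Av_i‖² ∈ [0,1]`, `P(√λ_i) ∈ [−1,1]`).
[cite: GharibianLegall2022, §2.2 eq. (3) and §4.1, proof of Theorem 3 (formal statement)
("`≤ 7ζ‖w‖‖v‖ ≤ 7ζ‖P(√(A†A))‖‖u‖‖v‖ ≤ 7ζ`")] -/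
theorem normSq_evenPolyApply_le {d : ℕ} (A : Matrix (Fin M) (Fin N) ℝ) (a : Fin (d + 1) → ℝ)
    (hA : ∀ x : Fin N → ℝ, normSq (A *ᵥ x) ≤ normSq x)
    (hP : ∀ x : ℝ, -1 ≤ x → x ≤ 1 → |∑ k : Fin (d + 1), a k * x ^ (2 * (k : ℕ))| ≤ 1)
    (u : Fin N → ℝ) : normSq (SparseQuery.evenPolyApply a A u) ≤ normSq u := by
  classical
  have hG : (Aᴴ * A).IsHermitian := isHermitian_conjTranspose_mul_self A
  set U : Matrix (Fin N) (Fin N) ℝ := (hG.eigenvectorUnitary : Matrix (Fin N) (Fin N) ℝ) with hUdef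
  set lam : Fin N → ℝ := hG.eigenvalues with hlam
  have hAH : Aᴴ = Aᵀ := conjTranspose_eq_transpose_of_trivial A
  have hstarU : star U = Uᵀ := by
    rw [star_eq_conjTranspose, conjTranspose_eq_transpose_of_trivial]
  have hUU : Uᵀ * U = 1 := by
    rw [← hstarU]; exact Unitary.coe_star_mul_self hG.eigenvectorUnitary
  have hUU' : U * Uᵀ = 1 := by
    rw [← hstarU]; exact Unitary.coe_mul_star_self hG.eigenvectorUnitary
  -- spectral theorem: AᴴA = U diag(λ) Uᵀ
  have hofReal : (RCLike.ofReal ∘ hG.eigenvalues : Fin N → ℝ) = lam := by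
    funext i
    simp [hlam]
  have hspec : Aᴴ * A = U * diagonal lam * Uᵀ := by
    have h := hG.spectral_theorem
    rw [Unitary.conjStarAlgAut_apply, hofReal] at h
    rw [← hstarU]
    exact h
  -- powers: (AᴴA)^k = U diag(λ^k) Uᵀ
  have hpow : ∀ k : ℕ, (Aᴴ * A) ^ k = U * diagonal (fun i => lam i ^ k) * Uᵀ := by
    intro k
    induction k with
    | zero =>
        simp only [pow_zero]
        have : (diagonal fun _ : Fin N => (1 : ℝ)) = 1 := diagonal_one
        rw [this, Matrix.mul_one, hUU']
    | succ k ih =>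
        rw [pow_succ, ih, hspec]
        calc U * diagonal (fun i => lam i ^ k) * Uᵀ * (U * diagonal lam * Uᵀ)
            = U * diagonal (fun i => lam i ^ k) * (Uᵀ * U) * diagonal lam * Uᵀ := by
              simp only [Matrix.mul_assoc]
          _ = U * (diagonal (fun i => lam i ^ k) * diagonal lam) * Uᵀ := by
              rw [hUU, Matrix.mul_one, Matrix.mul_assoc U]
          _ = U * diagonal (fun i => lam i ^ (k + 1)) * Uᵀ := by
              simp only [diagonal_mul_diagonal, pow_succ]
  -- eigenvalues lie in [0,1]: λ_j = ‖A v_j‖² with ‖v_j‖ = 1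
  have hlam01 : ∀ j, 0 ≤ lam j ∧ lam j ≤ 1 := by
    intro j
    set v : Fin N → ℝ := ⇑(hG.eigenvectorBasis j) with hv
    have hev : lam j = normSq (A *ᵥ v) := by
      have h := hG.eigenvalues_eq j
      rw [← hlam] at h
      rw [h, ← hv]
      simp only [RCLike.re_to_real, star_trivial]
      rw [normSq_eq_dotProduct, ← mulVec_mulVec, dotProduct_mulVec, hAH, ← vecMul_transpose]
    have hvU : v = U *ᵥ Pi.single j 1 := by
      rw [hv, hUdef, IsHermitian.eigenvectorUnitary_mulVec]
    have hv1 : normSq v = 1 := by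
      rw [hvU, normSq_mulVec_of_transpose_mul_self hUU]
      simp [normSq, Pi.single_apply, sq, Finset.sum_ite_eq']
    refine ⟨hev ▸ normSq_nonneg _, ?_⟩
    rw [hev]
    exact (hA v).trans_eq hv1
  -- the transformed vector: w = U diag(q) Uᵀ u with q_j = Σ a_k λ_j^k = P(√λ_j)
  set q : Fin N → ℝ := fun j => ∑ k : Fin (d + 1), a k * lam j ^ (k : ℕ) with hq
  have hq1 : ∀ j, |q j| ≤ 1 := by
    intro j
    obtain ⟨h0, h1⟩ := hlam01 j
    have hx := hP (Real.sqrt (lam j)) (by linarith [Real.sqrt_nonneg (lam j)])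
      (Real.sqrt_le_one.mpr h1 |>.trans_eq rfl)
    have hxe : ∀ k : Fin (d + 1), Real.sqrt (lam j) ^ (2 * (k : ℕ)) = lam j ^ (k : ℕ) := by
      intro k
      rw [pow_mul, Real.sq_sqrt h0]
    simp only [hxe] at hx
    exact hx
  set z : Fin N → ℝ := Uᵀ *ᵥ u with hz
  have hdiag : ∀ f v : Fin N → ℝ, diagonal f *ᵥ v = fun j => f j * v j :=
    fun f v => funext fun j => mulVec_diagonal f v j
  have hw : SparseQuery.evenPolyApply a A u = U *ᵥ (diagonal q *ᵥ z) := by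
    funext i
    simp only [SparseQuery.evenPolyApply, hpow, ← mulVec_mulVec]
    simp only [← hz, hdiag]
    simp only [mulVec, dotProduct, Finset.mul_sum]
    rw [Finset.sum_comm]
    refine Finset.sum_congr rfl fun j _ => ?_
    simp only [hq, Finset.sum_mul, Finset.mul_sum]
    refine Finset.sum_congr rfl fun k _ => ?_
    ring
  rw [hw, normSq_mulVec_of_transpose_mul_self hUU]
  refine (normSq_diagonal_mulVec_le hq1 z).trans ?_
  rw [hz]
  have hUtU : (Uᵀ)ᵀ * Uᵀ = 1 := by rw [transpose_transpose, hUU']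
  rw [normSq_mulVec_of_transpose_mul_self hUtU]


/-- **GL22 Theorem 3 (formal statement) with exactly the printed hypotheses**, real case: as
`sparseQSVT_estimation`, but with `‖A‖ ≤ 1` (as `∀ x, ‖Ax‖² ≤ ‖x‖²`), `‖u‖ ≤ 1` and
`|P(x)| ≤ 1` for `x ∈ [−1,1]` in place of the hypothesis on `w = P(√(AᵀA))u`, which now follows
from `normSq_evenPolyApply_le` ("`‖w‖ ≤ ‖P(√(A†A))‖‖u‖ ≤ 1`", via eq. (3)).
[cite: GharibianLegall2022, §4.1 Theorem 3 (formal statement) — problem `EST(s,ε,ζ)`: "query-access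
to an `s`-sparse matrix `A` with `‖A‖ ≤ 1`; query-access to a vector `u` such that `‖u‖ ≤ 1`;
`ζ`-sampling-access to a vector `v` such that `‖v‖ ≤ 1`; an even polynomial `P` of degree `2d`
such that `|P(x)| ≤ 1` for all `x ∈ [−1,1]`" — and its proof, Lemma 3, §2.2 eq. (3)] -/
theorem sparseQSVT_estimation_of_norm_le {d s : ℕ} (A : Matrix (Fin M) (Fin N) ℝ)
    (a : Fin (d + 1) → ℝ) (u : Fin N → ℝ) {rowO : SparseQuery.RowOracle (Fin M) (Fin N) ℝ}
    {colO : SparseQuery.RowOracle (Fin N) (Fin M) ℝ} (hr : rowO.Lists A) (hc : colO.Lists Aᵀ)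
    (hrw : rowO.Width s) (hcw : colO.Width s) {ζ : ℝ} {v : Fin N → ℝ} (S : ZetaSampling ζ v)
    (h0 : 0 ≤ ζ) {ε δ : ℝ} (hε : 0 < ε) (hε1 : ε ≤ 1) (hζ : ζ ≤ ε / 8) (hδ : 0 < δ)
    (hv : normSq v ≤ 1) (hA : ∀ x : Fin N → ℝ, normSq (A *ᵥ x) ≤ normSq x) (hu : normSq u ≤ 1)
    (hP : ∀ x : ℝ, -1 ≤ x → x ≤ 1 → |∑ k : Fin (d + 1), a k * x ^ (2 * (k : ℕ))| ≤ 1)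
    {x q : ℕ} (hx : 1024 / ε ^ 2 ≤ (x : ℝ)) (hq : 0 < q) (hqδ : 8 * Real.log (1 / δ) ≤ q)
    (med : (Fin q → Fin x → Fin N) → ℝ)
    (hmed : ∀ ω, IsMedian
      (fun i => blockMean (S.est (SparseQuery.recEvalPoly a (rowO.gram colO) u)) (ω i)) (med ω)) :
    (∑ ω ∈ univ.filter (fun ω : Fin q → Fin x → Fin N =>
        ε ≤ |med ω - ∑ j, v j * SparseQuery.evenPolyApply a A u j|), ∏ i, iidWeight S.p (ω i) ≤ δ)
    ∧ ∀ j, SparseQuery.leafQueriesPoly d (rowO.gram colO) j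
        ≤ ∑ k : Fin (d + 1), s ^ (2 * (k : ℕ)) :=
  sparseQSVT_estimation A a u hr hc hrw hcw S h0 hε hε1 hζ hδ hv
    ((normSq_evenPolyApply_le A a hA hP u).trans hu) hx hq hqδ med hmed

end spectral

/-! ### §4.2, Theorem 4 (formal version): singular value estimation by the dequantized QSVT -/

section svt

variable {M N : ℕ}

/-- The squared singular values `σ_i²` of a real `M × N` matrix, indexed by `[N]` with the padding
convention of eq. (2) (`σ_i = 0` beyond `min(M,N)`): the eigenvalues of `AᵀA`.
[cite: GharibianLegall2022, §2.2 eqs. (1)–(2) ("Such a decomposition is called a Singular Value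
Decomposition … for each `i ∈ {min(M,N)+1,…,N}` we set `σ_i = 0`")] -/
def singularValueSq (A : Matrix (Fin M) (Fin N) ℝ) : Fin N → ℝ :=
  (isHermitian_conjTranspose_mul_self A).eigenvalues

/-- The matrix `V` whose columns are the right singular vectors `v_i` (an orthonormal eigenbasis of
`AᵀA`). [cite: GharibianLegall2022, §2.2 eq. (1) ("`{v_i}_i` are orthonormal vectors in `ℂᴺ`")] -/
def rightSingularMatrix (A : Matrix (Fin M) (Fin N) ℝ) : Matrix (Fin N) (Fin N) ℝ :=
  ((isHermitian_conjTranspose_mul_self A).eigenvectorUnitary : Matrix (Fin N) (Fin N) ℝ)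

/-- The coefficients `α_i = ⟨v_i, u⟩` of `u` in the right singular basis (`u = ∑_i α_i v_i`).
[cite: GharibianLegall2022, §4.2, proof of Theorem 4 (formal version) ("Let us decompose `u` in the
basis `{v_i}`: `u = ∑_i α_i v_i`")] -/
def singularCoeff (A : Matrix (Fin M) (Fin N) ℝ) (u : Fin N → ℝ) : Fin N → ℝ :=
  (rightSingularMatrix A)ᵀ *ᵥ u

/-- `VᵀV = 1`. [cite: GharibianLegall2022, §2.2 eq. (1) (orthonormality of the `v_i`)] -/
theorem rightSingularMatrix_transpose_mul_self (A : Matrix (Fin M) (Fin N) ℝ) :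
    (rightSingularMatrix A)ᵀ * rightSingularMatrix A = 1 := by
  have hstar : star (rightSingularMatrix A) = (rightSingularMatrix A)ᵀ := by
    rw [star_eq_conjTranspose, conjTranspose_eq_transpose_of_trivial]
  rw [← hstar]
  exact Unitary.coe_star_mul_self (isHermitian_conjTranspose_mul_self A).eigenvectorUnitary

/-- `VVᵀ = 1` (the `v_i` form an orthonormal BASIS, eq. (2)). [cite: GharibianLegall2022, §2.2
eq. (2) ("so that `{v_i}` forms an orthonormal basis")] -/
theorem rightSingularMatrix_mul_transpose_self (A : Matrix (Fin M) (Fin N) ℝ) :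
    rightSingularMatrix A * (rightSingularMatrix A)ᵀ = 1 := by
  have hstar : star (rightSingularMatrix A) = (rightSingularMatrix A)ᵀ := by
    rw [star_eq_conjTranspose, conjTranspose_eq_transpose_of_trivial]
  rw [← hstar]
  exact Unitary.coe_mul_star_self (isHermitian_conjTranspose_mul_self A).eigenvectorUnitary

/-- **`AᵀA = V diag(σ²) Vᵀ`** (the spectral theorem for the real symmetric matrix `AᵀA`, i.e. the
singular value decomposition read on `A†A`). [cite: GharibianLegall2022, §2.2 eqs. (1)–(3)] -/
theorem conjTranspose_mul_self_eq (A : Matrix (Fin M) (Fin N) ℝ) :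
    Aᴴ * A = rightSingularMatrix A * diagonal (singularValueSq A) * (rightSingularMatrix A)ᵀ := by
  have hG := isHermitian_conjTranspose_mul_self A
  have hstar : star (rightSingularMatrix A) = (rightSingularMatrix A)ᵀ := by
    rw [star_eq_conjTranspose, conjTranspose_eq_transpose_of_trivial]
  have hofReal : (RCLike.ofReal ∘ hG.eigenvalues : Fin N → ℝ) = singularValueSq A := by
    funext i
    simp [singularValueSq]
  have h := hG.spectral_theorem
  rw [Unitary.conjStarAlgAut_apply, hofReal] at h
  rw [← hstar]
  exact h

/-- `(AᵀA)^k = V diag(σ^{2k}) Vᵀ`. [cite: GharibianLegall2022, §2.2 eq. (3)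
("`P(√(A†A)) = ∑_i P(σ_i) v_i v_i†`") applied to `P = x^{2k}`] -/
theorem conjTranspose_mul_self_pow_eq (A : Matrix (Fin M) (Fin N) ℝ) (k : ℕ) :
    (Aᴴ * A) ^ k
      = rightSingularMatrix A * diagonal (fun i => singularValueSq A i ^ k)
          * (rightSingularMatrix A)ᵀ := by
  set V := rightSingularMatrix A
  induction k with
  | zero =>
      simp only [pow_zero]
      rw [diagonal_one, Matrix.mul_one, rightSingularMatrix_mul_transpose_self]
  | succ k ih =>
      rw [pow_succ, ih, conjTranspose_mul_self_eq]
      calc V * diagonal (fun i => singularValueSq A i ^ k) * Vᵀ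
            * (V * diagonal (singularValueSq A) * Vᵀ)
          = V * diagonal (fun i => singularValueSq A i ^ k) * (Vᵀ * V)
              * diagonal (singularValueSq A) * Vᵀ := by
            simp only [Matrix.mul_assoc]
        _ = V * (diagonal (fun i => singularValueSq A i ^ k) * diagonal (singularValueSq A)) * Vᵀ := by
            rw [rightSingularMatrix_transpose_mul_self, Matrix.mul_one, Matrix.mul_assoc V]
        _ = V * diagonal (fun i => singularValueSq A i ^ (k + 1)) * Vᵀ := by
            simp only [diagonal_mul_diagonal, pow_succ]

/-- The right singular vectors are unit vectors: `‖v_i‖² = 1`. [cite: GharibianLegall2022, §2.2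
eq. (1)] -/
theorem normSq_rightSingular_col (A : Matrix (Fin M) (Fin N) ℝ) (i : Fin N) :
    normSq (fun j => rightSingularMatrix A j i) = 1 := by
  classical
  have hcol : (fun j => rightSingularMatrix A j i)
      = rightSingularMatrix A *ᵥ (Pi.single i 1 : Fin N → ℝ) := by
    funext j
    simp [mulVec, dotProduct, Pi.single_apply]
  rw [hcol, normSq_mulVec_of_transpose_mul_self (rightSingularMatrix_transpose_mul_self A)]
  simp [normSq, Pi.single_apply, sq, Finset.sum_ite_eq']

/-- **`σ_i² = ‖A v_i‖²**: the `i`-th squared singular value is the squared length of `A` applied to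
the `i`-th right singular vector. [cite: GharibianLegall2022, §2.2 eq. (1) (`A = ∑ σ_i u_i v_i†`,
so `Av_i = σ_i u_i`)] -/
theorem singularValueSq_eq_normSq (A : Matrix (Fin M) (Fin N) ℝ) (i : Fin N) :
    singularValueSq A i = normSq (A *ᵥ fun j => rightSingularMatrix A j i) := by
  have hG := isHermitian_conjTranspose_mul_self A
  set v : Fin N → ℝ := fun j => rightSingularMatrix A j i with hvdef
  have hv : ⇑(hG.eigenvectorBasis i) = v := by
    funext j
    rfl
  have h := hG.eigenvalues_eq i
  rw [hv] at h
  change hG.eigenvalues i = _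
  rw [h]
  simp only [RCLike.re_to_real, star_trivial]
  have hAH : Aᴴ = Aᵀ := conjTranspose_eq_transpose_of_trivial A
  rw [normSq_eq_dotProduct, ← mulVec_mulVec, dotProduct_mulVec, hAH, ← vecMul_transpose]

/-- `σ_i² ≥ 0`. [cite: GharibianLegall2022, §2.2 ("the `σ_i`'s are nonnegative real numbers")] -/
theorem singularValueSq_nonneg (A : Matrix (Fin M) (Fin N) ℝ) (i : Fin N) :
    0 ≤ singularValueSq A i := by
  rw [singularValueSq_eq_normSq]
  exact normSq_nonneg _

/-- `‖A‖ ≤ 1 ⇒ σ_i² ≤ 1`. [cite: GharibianLegall2022, §4.2 (input: "`A` with `‖A‖ ≤ 1`"; the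
`σ_i` then lie in `[0,1]`)] -/
theorem singularValueSq_le_one {A : Matrix (Fin M) (Fin N) ℝ}
    (hA : ∀ x : Fin N → ℝ, normSq (A *ᵥ x) ≤ normSq x) (i : Fin N) : singularValueSq A i ≤ 1 := by
  rw [singularValueSq_eq_normSq]
  exact (hA _).trans_eq (normSq_rightSingular_col A i)

variable {d : ℕ}

/-- The even polynomial read on squared arguments: `P̃(y) = ∑_k a_k y^k`, so that
`P(x) = P̃(x²)` for `P(x) = ∑_k a_k x^{2k}` and `P(σ_i) = P̃(σ_i²)`.
[cite: GharibianLegall2022, §2.2 ("`P(√(A†A)) = a_0 I + a_2 A†A + ⋯ + a_{2d}(A†A)^d`")] -/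
def evenPolyVal (a : Fin (d + 1) → ℝ) (y : ℝ) : ℝ := ∑ k : Fin (d + 1), a k * y ^ (k : ℕ)

/-- **Eq. (3) applied to a vector**: `P(√(AᵀA))u = V diag(P(σ_i)) Vᵀ u`.
[cite: GharibianLegall2022, §2.2 eq. (3) and §4.2, proof of Theorem 4 (formal version)
("`P(√(A†A))u = (∑_i P(σ_i)v_iv_i†)(∑_i α_i v_i) = ∑_i P(σ_i)α_i v_i`")] -/
theorem evenPolyApply_eq_conj (a : Fin (d + 1) → ℝ) (A : Matrix (Fin M) (Fin N) ℝ)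
    (u : Fin N → ℝ) :
    SparseQuery.evenPolyApply a A u = rightSingularMatrix A *ᵥ
      (diagonal (fun i => evenPolyVal a (singularValueSq A i)) *ᵥ singularCoeff A u) := by
  classical
  have hdiag : ∀ f v : Fin N → ℝ, diagonal f *ᵥ v = fun j => f j * v j :=
    fun f v => funext fun j => mulVec_diagonal f v j
  have hz : (rightSingularMatrix A)ᵀ *ᵥ u = singularCoeff A u := rfl
  funext i
  simp only [SparseQuery.evenPolyApply, conjTranspose_mul_self_pow_eq, ← mulVec_mulVec]
  simp only [hz, hdiag]
  generalize singularCoeff A u = z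
  simp only [mulVec, dotProduct, Finset.mul_sum]
  rw [Finset.sum_comm]
  refine Finset.sum_congr rfl fun j _ => ?_
  simp only [evenPolyVal, Finset.sum_mul, Finset.mul_sum]
  refine Finset.sum_congr rfl fun k _ => ?_
  ring

/-- `∑_i |α_i|² = ‖u‖²` (Parseval in the right singular basis).
[cite: GharibianLegall2022, §4.2, proof of Theorem 4 (formal version) ("by assumption we have
`∑_i |α_i|² ≤ 1`")] -/
theorem sum_singularCoeff_sq (A : Matrix (Fin M) (Fin N) ℝ) (u : Fin N → ℝ) :
    ∑ i, singularCoeff A u i ^ 2 = normSq u := by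
  have h := normSq_mulVec_of_transpose_mul_self (U := (rightSingularMatrix A)ᵀ)
    (by rw [transpose_transpose, rightSingularMatrix_mul_transpose_self]) u
  exact h

/-- **`u† P(√(A†A)) u = ∑_i P(σ_i)|α_i|²`** ("is a real number").
[cite: GharibianLegall2022, §4.2, proof of Theorem 4 (formal version) ("Observe that
`u†P(√(A†A))u = ∑_i P(σ_i)|α_i|²`")] -/
theorem inner_evenPolyApply (a : Fin (d + 1) → ℝ) (A : Matrix (Fin M) (Fin N) ℝ)
    (u : Fin N → ℝ) :
    ∑ j, u j * SparseQuery.evenPolyApply a A u j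
      = ∑ i, evenPolyVal a (singularValueSq A i) * singularCoeff A u i ^ 2 := by
  classical
  rw [evenPolyApply_eq_conj]
  have h : ∑ j, u j * (rightSingularMatrix A *ᵥ
      (diagonal (fun i => evenPolyVal a (singularValueSq A i)) *ᵥ singularCoeff A u)) j
      = u ⬝ᵥ (rightSingularMatrix A *ᵥ
        (diagonal (fun i => evenPolyVal a (singularValueSq A i)) *ᵥ singularCoeff A u)) := rfl
  rw [h, dotProduct_mulVec, ← mulVec_transpose]
  unfold singularCoeff
  simp only [dotProduct, mulVec_diagonal]
  refine Finset.sum_congr rfl fun i _ => ?_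
  ring

/-- **Case (i) of the proof of Theorem 4**: if `P ≥ 0` on every `σ_i`, `P(σ_i) ≥ 1 − χ` for the
singular values in `[t₁,t₂]`, and `‖Π^{[t₁,t₂]}_A u‖² = ∑_{σ_i ∈ [t₁,t₂]} |α_i|² ≥ δ²`, then
`u†P(√(A†A))u ≥ ∑_{i∈Λ} P(σ_i)|α_i|² ≥ (1−χ)δ²`.
[cite: GharibianLegall2022, §4.2, proof of Theorem 4 (formal version), first display chain
("`≥ ∑_{i∈Λ}(1−χ)|α_i|² ≥ (1−χ)δ² ≥ 2δ²/3`")] -/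
theorem inner_evenPolyApply_ge (a : Fin (d + 1) → ℝ) (A : Matrix (Fin M) (Fin N) ℝ)
    (u : Fin N → ℝ) {χ δ t₁ t₂ : ℝ} (hχ : χ ≤ 1)
    (hP0 : ∀ i, 0 ≤ evenPolyVal a (singularValueSq A i))
    (hPin : ∀ i, t₁ ≤ Real.sqrt (singularValueSq A i) → Real.sqrt (singularValueSq A i) ≤ t₂ →
      1 - χ ≤ evenPolyVal a (singularValueSq A i))
    (hover : δ ^ 2 ≤ ∑ i ∈ univ.filter (fun i => t₁ ≤ Real.sqrt (singularValueSq A i) ∧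
      Real.sqrt (singularValueSq A i) ≤ t₂), singularCoeff A u i ^ 2) :
    (1 - χ) * δ ^ 2 ≤ ∑ j, u j * SparseQuery.evenPolyApply a A u j := by
  classical
  rw [inner_evenPolyApply]
  set Λ := univ.filter (fun i => t₁ ≤ Real.sqrt (singularValueSq A i) ∧
      Real.sqrt (singularValueSq A i) ≤ t₂)
  calc (1 - χ) * δ ^ 2 ≤ (1 - χ) * ∑ i ∈ Λ, singularCoeff A u i ^ 2 :=
        mul_le_mul_of_nonneg_left hover (by linarith)
    _ = ∑ i ∈ Λ, (1 - χ) * singularCoeff A u i ^ 2 := by rw [Finset.mul_sum]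
    _ ≤ ∑ i ∈ Λ, evenPolyVal a (singularValueSq A i) * singularCoeff A u i ^ 2 :=
        sum_le_sum fun i hi => by
          have h := (mem_filter.1 hi).2
          exact mul_le_mul_of_nonneg_right (hPin i h.1 h.2) (sq_nonneg _)
    _ ≤ ∑ i, evenPolyVal a (singularValueSq A i) * singularCoeff A u i ^ 2 :=
        sum_le_sum_of_subset_of_nonneg (filter_subset _ _)
          fun i _ _ => mul_nonneg (hP0 i) (sq_nonneg _)

/-- **Case (ii) of the proof of Theorem 4**: if `P(σ_i) ≤ χ` for every `i` and `‖u‖ ≤ 1`, then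
`u†P(√(A†A))u ≤ χ∑|α_i|² ≤ χ`. [cite: GharibianLegall2022, §4.2, proof of Theorem 4 (formal
version), second display ("`≤ ∑_i χ|α_i|² ≤ χ ≤ δ²/3`")] -/
theorem inner_evenPolyApply_le (a : Fin (d + 1) → ℝ) (A : Matrix (Fin M) (Fin N) ℝ)
    (u : Fin N → ℝ) {χ : ℝ} (hχ0 : 0 ≤ χ) (hu : normSq u ≤ 1)
    (hPout : ∀ i, evenPolyVal a (singularValueSq A i) ≤ χ) :
    ∑ j, u j * SparseQuery.evenPolyApply a A u j ≤ χ := by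
  rw [inner_evenPolyApply]
  calc ∑ i, evenPolyVal a (singularValueSq A i) * singularCoeff A u i ^ 2
      ≤ ∑ i, χ * singularCoeff A u i ^ 2 :=
        sum_le_sum fun i _ => mul_le_mul_of_nonneg_right (hPout i) (sq_nonneg _)
    _ = χ * normSq u := by rw [← Finset.mul_sum, sum_singularCoeff_sq]
    _ ≤ χ * 1 := mul_le_mul_of_nonneg_left hu hχ0
    _ = χ := mul_one χ

/-- **GL22 Theorem 4 (formal version) — singular value estimation by dequantizing the QSVT —
real case, decision step.**  Problem `SV(s,t₁,t₂,θ₁,θ₂,δ,ζ)`: input the two Def.-2 oracles of an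
`s`-sparse real `A` with `‖A‖ ≤ 1` and `ζ`-sampling-access to `u` (`‖u‖ ≤ 1`); promise (i) `A` has a
singular value in `[t₁,t₂]` and `‖Π^{[t₁,t₂]}_A u‖ ≥ δ`, or (ii) `A` has no singular value in
`(t₁−θ₁, t₂+θ₂)`.  Algorithm (as printed): take the even polynomial `P` of Lemma 4 with
`χ = δ²/3` — here ANY even `P = ∑_{k≤d} a_k x^{2k}` with the three properties Lemma 4 provides
(`P ∈ [0,1]` on `[0,1]`; `P ≥ 1−χ` on `[t₁,t₂]`; `P ≤ χ` on `[0,t₁−θ₁] ∪ [t₂+θ₂,1]`), taken as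
hypotheses — run `EST(s, ε = δ²/7, ζ)` on `(A,u,u,P)` (the estimator of Theorem 3, `w_j` by the
recursion of Lemma 3) and answer (i) iff the output exceeds `δ²/2`.  Then in case (i)
`u†P(√(A†A))u ≥ 2δ²/3` and in case (ii) `≤ δ²/3`, so with `ζ ≤ δ²/56 = ε/8`, `r ≥ 1024/ε²`
samples per mean and `q ≥ 8 ln(1/η)` means the answer is wrong only on outcomes of weight `≤ η`
(`η = 1/poly(N)` in the paper).  The degree of `P` (Lemma 4:
`O((1/θ₁ + 1/θ₂) log(1/χ))`) enters only the per-entry query count `∑_{k≤d} s^{2k}` of Lemma 3.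
[cite: GharibianLegall2022, §4.2 Theorem 4 (formal version: "`SV(s,t₁,t₂,θ₁,θ₂,δ,ζ)` can be
solved classically with probability at least `1 − 1/poly(N)` in
`Õ(s^{c(1/θ₁+1/θ₂)log(√3/δ)}/δ⁴)` time … for any `ζ ≤ δ²/56`") and its proof ("Using the
algorithm `EST(s,ε,ζ)` on input `(A,u,u,P)` with `ε = δ²/7`"); Lemma 4 (the polynomial, from
[Low–Chuang 2017] / [GSLW19, Lemma 29]) is the hypothesis `hP01`/`hPin`/`hPout`] -/
theorem singularValue_decision {s : ℕ} (A : Matrix (Fin M) (Fin N) ℝ) (a : Fin (d + 1) → ℝ)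
    (u : Fin N → ℝ) {rowO : SparseQuery.RowOracle (Fin M) (Fin N) ℝ}
    {colO : SparseQuery.RowOracle (Fin N) (Fin M) ℝ} (hr : rowO.Lists A) (hc : colO.Lists Aᵀ)
    (hrw : rowO.Width s) (hcw : colO.Width s) {ζ : ℝ} (S : ZetaSampling ζ u) (h0 : 0 ≤ ζ)
    {δ t₁ t₂ θ₁ θ₂ : ℝ} (hδ : 0 < δ) (hδ1 : δ ≤ 1) (hζ : ζ ≤ δ ^ 2 / 56)
    (hA : ∀ x : Fin N → ℝ, normSq (A *ᵥ x) ≤ normSq x) (hu : normSq u ≤ 1)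
    (hP01 : ∀ y : ℝ, 0 ≤ y → y ≤ 1 → 0 ≤ evenPolyVal a y ∧ evenPolyVal a y ≤ 1)
    (hPin : ∀ y : ℝ, 0 ≤ y → y ≤ 1 → t₁ ≤ Real.sqrt y → Real.sqrt y ≤ t₂ →
      1 - δ ^ 2 / 3 ≤ evenPolyVal a y)
    (hPout : ∀ y : ℝ, 0 ≤ y → y ≤ 1 → (Real.sqrt y ≤ t₁ - θ₁ ∨ t₂ + θ₂ ≤ Real.sqrt y) →
      evenPolyVal a y ≤ δ ^ 2 / 3)
    {η : ℝ} (hη : 0 < η) {x q : ℕ} (hx : 1024 / (δ ^ 2 / 7) ^ 2 ≤ (x : ℝ)) (hq : 0 < q)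
    (hqη : 8 * Real.log (1 / η) ≤ q) (med : (Fin q → Fin x → Fin N) → ℝ)
    (hmed : ∀ ω, IsMedian
      (fun i => blockMean (S.est (SparseQuery.recEvalPoly a (rowO.gram colO) u)) (ω i)) (med ω)) :
    ((δ ^ 2 ≤ ∑ i ∈ univ.filter (fun i => t₁ ≤ Real.sqrt (singularValueSq A i) ∧
          Real.sqrt (singularValueSq A i) ≤ t₂), singularCoeff A u i ^ 2) →
      ∑ ω ∈ univ.filter (fun ω : Fin q → Fin x → Fin N => med ω ≤ δ ^ 2 / 2),
        ∏ i, iidWeight S.p (ω i) ≤ η)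
    ∧ ((∀ i, ¬ (t₁ - θ₁ < Real.sqrt (singularValueSq A i) ∧
          Real.sqrt (singularValueSq A i) < t₂ + θ₂)) →
      ∑ ω ∈ univ.filter (fun ω : Fin q → Fin x → Fin N => δ ^ 2 / 2 < med ω),
        ∏ i, iidWeight S.p (ω i) ≤ η) := by
  classical
  -- the EST guarantee at ε = δ²/7
  have hε : 0 < δ ^ 2 / 7 := by positivity
  have hε1 : δ ^ 2 / 7 ≤ 1 := by nlinarith
  have hζ' : ζ ≤ δ ^ 2 / 7 / 8 := by
    have : δ ^ 2 / 7 / 8 = δ ^ 2 / 56 := by ring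
    rw [this]; exact hζ
  have hPabs : ∀ x : ℝ, -1 ≤ x → x ≤ 1 → |∑ k : Fin (d + 1), a k * x ^ (2 * (k : ℕ))| ≤ 1 := by
    intro x hx1 hx2
    have hy0 : 0 ≤ x ^ 2 := sq_nonneg x
    have hy1 : x ^ 2 ≤ 1 := by nlinarith
    have hrew : ∑ k : Fin (d + 1), a k * x ^ (2 * (k : ℕ)) = evenPolyVal a (x ^ 2) := by
      simp only [evenPolyVal, pow_mul]
    rw [hrew, abs_le]
    obtain ⟨h1, h2⟩ := hP01 (x ^ 2) hy0 hy1
    exact ⟨by linarith, h2⟩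
  have hest := (sparseQSVT_estimation_of_norm_le A a u hr hc hrw hcw S h0 hε hε1 hζ' hη hu hA hu
    hPabs hx hq hqη med hmed).1
  set μ := ∑ j, u j * SparseQuery.evenPolyApply a A u j with hμ
  have hW0 : ∀ ω : Fin q → Fin x → Fin N, 0 ≤ ∏ i, iidWeight S.p (ω i) :=
    fun ω => prod_nonneg fun i _ => iidWeight_nonneg S.p_nonneg _
  -- σ_i ∈ [0,1]
  have hσ : ∀ i, 0 ≤ singularValueSq A i ∧ singularValueSq A i ≤ 1 :=
    fun i => ⟨singularValueSq_nonneg A i, singularValueSq_le_one hA i⟩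
  have hδ2 : 0 ≤ δ ^ 2 := sq_nonneg δ
  refine ⟨fun hover => ?_, fun hno => ?_⟩
  · -- case (i): μ ≥ (1 − δ²/3)δ² ≥ 2δ²/3, so `med ≤ δ²/2` forces `|med − μ| ≥ δ²/6 ≥ δ²/7`
    have hμ_ge : (1 - δ ^ 2 / 3) * δ ^ 2 ≤ μ :=
      inner_evenPolyApply_ge a A u (by nlinarith) (fun i => (hP01 _ (hσ i).1 (hσ i).2).1)
        (fun i h1 h2 => hPin _ (hσ i).1 (hσ i).2 h1 h2) hover
    have hδ4 : δ ^ 2 * δ ^ 2 ≤ δ ^ 2 * 1 :=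
      mul_le_mul_of_nonneg_left (by nlinarith) hδ2
    have hμ23 : 2 * δ ^ 2 / 3 ≤ μ := by nlinarith
    refine (sum_le_sum_of_subset_of_nonneg ?_ fun ω _ _ => hW0 ω).trans hest
    intro ω hω
    simp only [Finset.mem_filter, Finset.mem_univ, true_and] at hω ⊢
    rw [abs_sub_comm, abs_of_nonneg (by linarith)]
    linarith
  · -- case (ii): μ ≤ δ²/3, so `med > δ²/2` forces `|med − μ| > δ²/6 ≥ δ²/7`
    have hPout' : ∀ i, evenPolyVal a (singularValueSq A i) ≤ δ ^ 2 / 3 := by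
      intro i
      refine hPout _ (hσ i).1 (hσ i).2 ?_
      rcases le_or_gt (Real.sqrt (singularValueSq A i)) (t₁ - θ₁) with h1 | h1
      · exact Or.inl h1
      · rcases le_or_gt (t₂ + θ₂) (Real.sqrt (singularValueSq A i)) with h2 | h2
        · exact Or.inr h2
        · exact absurd ⟨h1, h2⟩ (hno i)
    have hμ_le : μ ≤ δ ^ 2 / 3 := inner_evenPolyApply_le a A u (by positivity) hu hPout'
    refine (sum_le_sum_of_subset_of_nonneg ?_ fun ω _ _ => hW0 ω).trans hest
    intro ω hω
    simp only [Finset.mem_filter, Finset.mem_univ, true_and] at hω ⊢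
    rw [abs_of_nonneg (by linarith)]
    linarith

end svt

/-! ### §4.3: from gapped threshold decisions to an additive estimate (proof of Theorem 1 from Proposition 1) -/

section intervalScan

/-- **GL22 §4.3 — from gapped threshold decisions to an additive estimate** (the proof of Theorem 1,
"`GLHest` … can be solved classically", from Proposition 1).  Decompose `[−1,1]` into `2r`
intervals `[a_i, b_i] = [(i−r−1)/r, (i−r)/r]`, `i = 1,…,2r` (here `i : Fin (2r)` stands for the
paper's `i+1`), and suppose a decision procedure answers, for each `i`, "`λ ≤ a_i`" or "`λ ≥ b_i`"
(`ge i`), never erring: `λ ≤ a_i ⇒` it answers "`≤`", `λ ≥ b_i ⇒` it answers "`≥`" (arbitrary when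
`λ ∈ (a_i,b_i)`).  Then the answers are "`≥`" exactly up to some `i₀` and the paper's three cases
(a) `i₀ = 0`, (b) `i₀ = 2r`, (c) otherwise conclude `λ ∈ [(i₀−r−1)/r, (i₀−r+1)/r]`; with
`i₀ = #{i : answer "≥"}` this is the single statement `|λ − (i₀ − r)/r| ≤ 1/r`, so `r = 2/ε`… — in
fact any `r ≥ 1/ε` — gives an `ε`-additive approximation.  (`λ ∈ [−1,1]`: the paper's `‖H‖ ≤ 1`.)
[cite: GharibianLegall2022, §4.3, proof of Theorem 1 from Proposition 1 ("decompose the interval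
`[−1,1]` into `2r` intervals … One of the following three cases necessarily occurs … Taking
`r = 2/ε` thus guarantees that we get an `ε`-additive-approximation of `λ_H`")] -/
theorem thresholdScan_estimate {r : ℕ} (hr : 0 < r) {lam : ℝ} (hl1 : -1 ≤ lam) (hl2 : lam ≤ 1)
    (ge : Fin (2 * r) → Prop) [DecidablePred ge]
    (h_le : ∀ i : Fin (2 * r), lam ≤ (((i : ℕ) : ℝ) - r) / r → ¬ ge i)
    (h_ge : ∀ i : Fin (2 * r), (((i : ℕ) : ℝ) + 1 - r) / r ≤ lam → ge i) :
    |(((univ.filter ge).card : ℝ) - r) / r - lam| ≤ 1 / r := by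
  classical
  have hr' : (0 : ℝ) < r := Nat.cast_pos.2 hr
  set t : ℝ := (r : ℝ) * (lam + 1) with ht
  have ht0 : 0 ≤ t := mul_nonneg hr'.le (by linarith)
  have ht2 : t ≤ ((2 * r : ℕ) : ℝ) := by
    push_cast
    nlinarith
  set c := (univ.filter ge).card with hc
  -- lower bound: every i < ⌊t⌋₊ satisfies b_i ≤ λ, hence answers "≥"
  have hlow : ⌊t⌋₊ ≤ c := by
    have hsub : (univ.filter fun i : Fin (2 * r) => (i : ℕ) < ⌊t⌋₊) ⊆ univ.filter ge := by
      intro i hi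
      simp only [mem_filter, mem_univ, true_and] at hi ⊢
      apply h_ge
      rw [div_le_iff₀ hr']
      have h1 : ((i : ℕ) : ℝ) + 1 ≤ (⌊t⌋₊ : ℝ) := by exact_mod_cast Nat.succ_le_of_lt hi
      have h2 : (⌊t⌋₊ : ℝ) ≤ t := Nat.floor_le ht0
      have h3 : ((i : ℕ) : ℝ) + 1 ≤ (r : ℝ) * (lam + 1) := h1.trans h2
      linarith
    have hcard := card_le_card hsub
    rw [Fin.card_filter_val_lt] at hcard
    have hfl : ⌊t⌋₊ ≤ 2 * r := Nat.floor_le_of_le ht2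
    rwa [min_eq_right hfl] at hcard
  -- upper bound: an index answering "≥" has a_i < λ, hence i < t ≤ ⌈t⌉₊
  have hup : c ≤ ⌈t⌉₊ := by
    have hsub : univ.filter ge ⊆ (univ.filter fun i : Fin (2 * r) => (i : ℕ) < ⌈t⌉₊) := by
      intro i hi
      simp only [mem_filter, mem_univ, true_and] at hi ⊢
      rw [Nat.lt_ceil]
      by_contra hcon
      have hti : t ≤ ((i : ℕ) : ℝ) := not_lt.1 hcon
      refine h_le i ?_ hi
      rw [le_div_iff₀ hr']
      linarith
    have hcard := card_le_card hsub
    rw [Fin.card_filter_val_lt] at hcard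
    exact hcard.trans (min_le_right _ _)
  -- |c − t| ≤ 1
  have hceil : (⌈t⌉₊ : ℝ) ≤ (⌊t⌋₊ : ℝ) + 1 := by exact_mod_cast Nat.ceil_le_floor_add_one t
  have hfloor : (⌊t⌋₊ : ℝ) ≤ t := Nat.floor_le ht0
  have hlt : t < (⌊t⌋₊ : ℝ) + 1 := Nat.lt_floor_add_one t
  have hc1 : (c : ℝ) ≤ t + 1 := by
    have : (c : ℝ) ≤ (⌈t⌉₊ : ℝ) := by exact_mod_cast hup
    linarith
  have hc2 : t - 1 < (c : ℝ) := by
    have : (⌊t⌋₊ : ℝ) ≤ (c : ℝ) := by exact_mod_cast hlow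
    linarith
  have key : (((c : ℝ)) - r) / r - lam = ((c : ℝ) - t) / r := by
    rw [ht]
    field_simp
    ring
  rw [key, abs_div, abs_of_pos hr', div_le_div_iff_of_pos_right hr', abs_le]
  constructor <;> linarith

end intervalScan

end SampleQuery

end Literature.Computability.QuantumComplexity

end
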